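import Literature.Barriers.SmoothPoincare4.CappellShanesonFamilyStandard
import Literature.Topology.FourManifolds.CappellShanesonTraceClasses
import Literature.Topology.FourManifolds.CappellShanesonDeltaMove
import Literature.Topology.FourManifolds.GompfSectionCircleFramings
import Literature.Topology.FourManifolds.GompfFramedTwistZero
import HarnessLib

/-!
# Towards `gompf2010_theorem32_d_holds`: the assembly of Gompf 2010, Thm. 3.2 (`|d| < 17`)

Sibling proof file of `Literature/Barriers/SmoothPoincare4/CappellShanesonFamilyStandard.lean`,
working towards its named fact `Literature.Barriers.SmoothPoincare4.gompf2010_theorem32_d`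
(R. Gompf, *More Cappell–Shaneson spheres are standard*, Algebr. Geom. Topol. 10 (2010), Thm. 3.2,
last sentence): for `A ∈ SL(3, ℤ)` in standard form `!![0, a, b; 0, c, d; 1, e, f]` with
`det (A - I) = 1` and `|d| < 17`, every Cappell–Shaneson sphere of `A` (either framing) is
diffeomorphic to `S⁴`. Provefact triage: **XL** — the fact packages Gompf's Thm. 2.1 (logarithmic
transformations in a fishtail neighbourhood), Thm. 4.3 (the two framings of `A₀`) and Akbulut–Kirby
1979 (a cancelling handle diagram), plus the Aitchison–Rubinstein class-number computation. It is
therefore DECOMPOSED along the printed proof, and this file proves the **assembly** sorry-free.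

## Gompf's proof of Thm. 3.2 and its decomposition

Printed proof (§3): "As above [Δ-moves change `tr(A)` by any multiple of `d`], we can assume
`tr(A) = r`. For each of the listed values of `r` [`-6 ≤ r ≤ 9`] except `-5`, there is only one
conjugacy class with trace `r` (see [AR] for `r = -6, 11`), so `A` is conjugate to `A_{r-2}`, and
the result follows from Example 3.1(a). The remaining case is settled by (b) above. The last
sentence follows once we rule out the case `d = 0` by the following lemma [Lemma 3.3]."

Leaves (named facts, the hypotheses of `gompf2010_theorem32_d_of`):

* `Literature.Topology.FourManifolds.gompf2010_deltaMove` (Thm. 2.1/§3, XL, topological),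
  `Literature.Topology.FourManifolds.gompf2010_akbulutKirby_framings` (Thm. 4.3, XL, topological),
  `Literature.Topology.FourManifolds.akbulutKirby1979_sphere_four` ([AK1], XL, topological) — the
  three leaves of Examples 3.1(a) isolated in `CappellShanesonGompfReduction.lean`, whose assembly
  `nonempty_diffeomorph_sphere_four_of_isCappellShanesonSphereOf_of` (every sphere of every `Aₘ` is
  `S⁴`) is reused here;
* `Literature.Topology.FourManifolds.aitchisonRubinstein1984_uniqueTraceClass` (one conjugacy
  class for each trace in `[-4, 9]`) and
  `Literature.Topology.FourManifolds.aitchisonRubinstein1984_traceNegFiveClasses` (trace `-5`: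
  the classes of `A₋₇` and of `B = !![0, -5, -8; 0, 2, 3; 1, 0, -7]`), the number-theoretic named
  facts of `CappellShanesonTraceClasses.lean` ([AR] Appendix, Newman's theorem and Table 1; size L:
  Latimer–MacDuffee–Taussky plus cubic class-number computations).

Proved in `CappellShanesonTraceClasses.lean`: Lemma 3.3 (`IsGompfStandardForm.odd_apply_one_two`,
so `d` is odd and `|d| ≤ 15`), `tr (Δ ^ k * A) = tr A + k d`, the residue window `[-5, 9]`
(`exists_add_mul_mem_Icc_of_odd`; fifteen consecutive integers suffice because `d` is odd, so
Gompf's `r = -6` is never needed), and Examples 3.1(b) as the conjugacy `Δ² B ∼ A₋₁`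
(`isConj_gompfDelta_sq_mul_gompfTraceNegFiveMatrix`). Proved here: the chain `X` (sphere of `A`)
`≅ X'` (sphere of `Δ ^ k * A ∼ Aₘ`, Δ-move) ⟹ `X'` and hence `X` is a sphere of `Aₘ` (conjugation
invariance `IsCappellShanesonSphereOf.of_isConj` and transport
`IsCappellShanesonSphereOf.of_diffeomorph`, both proved in the tree) ⟹ `X ≅ S⁴` (Examples 3.1(a));
in the second trace-`-5` class the same chain runs through `B` and one more Δ-move (`k = 2`) to
`A₋₁`. Only `gompf2010_deltaMove` at the universe of `X` is needed, because every Δ-move is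
applied to `X` itself after transporting the sphere structure back along the diffeomorphism.

Also recorded: the shorter (historically circular, formally fine) reduction through the tree's
named fact `kimYamada2023_nonempty_diffeomorph_sphere_four_of_trace_mem_Icc` (Kim–Yamada 2023,
Thm. B with Remark 1.1: traces in `[-64, 69]` are standard) and `gompf2010_deltaMove` alone
(`gompf2010_theorem32_d_of_kimYamada`).

## What remains for `gompf2010_theorem32_d_holds`

`gompf2010_theorem32_d_holds = gompf2010_theorem32_d_of hΔ h43 hAK hAR hAR5` once the five leaves
are discharged: three XL topological leaves (status in `CappellShanesonGompfReduction.lean`,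
`CappellShanesonDeltaMove.lean`, `GompfFramedSpheres.lean`) and the two [AR] facts.

## Part II — Cor. 3.5 from Thm. 2.1, Thm. 4.3, [AK1] and [AR]

The second half of this file (sections `Algebra` … `Corollary35`, appended by the provefact unit
of the former named fact `gompf2010_corollary35` of the sibling barrier file) proves, from the
leaves, Gompf 2010, Cor. 3.5: "If a Cappell-Shaneson homotopy sphere is
not diffeomorphic to `S⁴`, then its matrix, in standard form, must have `|d| ≥ 17`,
`|a + ce| ≥ 9`, `|c - 1/2| > 4` and `|c + f - 3/2| > 8`. □" (p. 8 of arXiv:0908.1914; for `A` in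
standard form with `det (A - 1) = 1` and a Cappell–Shaneson sphere `X ≇ S⁴` of `A`:
`17 ≤ |d|`, `9 ≤ |a + ce|`, `8 < |2c - 1|`, `16 < |2(c + f) - 3|`, the last two doubled to stay in
`ℤ`). D-0026/D-0027 review of that fact, 2026-08-15: as an OBLIGATION the corollary is an assembly
node — its discharge is `gompf2010_corollary35_of_framedTwist_AK`
(`CappellShanesonFamilyStandardHolds.lean`) applied to the discharges of the two live geometric
leaves **F** = `Literature.Topology.FourManifolds.gompf2010_framedTwist` and
[AK1] = `Literature.Topology.FourManifolds.akbulutKirby1979_linearStraightening`, every piece of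
glue being proved — so, exactly as for Thm. 3.4 below, the named fact is MERGED back into the
barrier entry: the `Prop` constant is retired from the sibling file and the statement of Cor. 3.5,
verbatim its former body, is the literal conclusion of the proved theorems
`gompf2010_corollary35_of_theorem32_of_modEq_sum`, `gompf2010_corollary35_of_theorems`,
`gompf2010_corollary35_of_leaves` (section `Corollary35`),
`gompf2010_corollary35_of_leaves_of_negFive` (`CappellShanesonFamilyStandardNegSixEleven.lean`) and
`gompf2010_corollary35_of_framedTwist_AK` (`CappellShanesonFamilyStandardHolds.lean`), which keep
their names; the barrier file quotes it as the hypothesis of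
`cappellShanesonSmallEntryBarrier_of_corollary35`. The printed proof is the box: the
corollary contraposes Thm. 3.2 (first sentence: "`tr(A) ≡ r` mod `d` for some `r` such that
`-6 ≤ r ≤ 9` or there is only one conjugacy class with trace `r`" ⟹ standard) and Thm. 3.4
("`c ≡ r` mod `d` or mod `a + ce` where `-3 ≤ r ≤ 4`" ⟹ standard). Provefact triage `XL` (same
leaves as above, plus the trace `-6`). Proved here, sorry-free:

* §3 matrix algebra beyond Lemma 3.3: `(a + ce) d = c(c-1)(f-1) + 1`, hence `a + ce` odd; the
  entries of the row move `Δᵏ A`, of the column move `A Δᵏ` (with `det (A Δᵏ - 1) = det (A - 1)`),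
  of the shear conjugation resetting `e` (`entries_shear_conj`), and of move (i) of the proof of
  Thm. 3.4 (`moveOneConj`, `entries_moveOne_conj`); a general residue window
  (`exists_add_mul_mem_Icc`).
* the **column move** `A ↦ A Δᵏ` does not change the spheres, as a THEOREM **from the row move
  `gompf2010_deltaMove`** (`gompf2010_deltaMoveRight_of_deltaMove`: the column move is the
  conjugate of the row move, `P A = A⁻¹ (A P) A`, and surgered mapping tori are invariant under
  based conjugation — `IsSurgeredMappingTorusOf.torusDiffeomorph_mul_comm`,
  `CappellShanesonDeltaMove.lean`; Gompf §3 ¶3: "or by the conjugate operation on the second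
  column"). (D-0026, 2026-08-15: the earlier derivation from the retired duplicate leaf
  "Theorem 2.1 on the torus", proved equivalent to `gompf2010_deltaMove`, is merged into this one.
  D-0026/D-0027 review, 2026-08-15: the column move was at first ALSO recorded as a separate named
  fact of this file — a `Prop`-valued constant named like the theorem without `_of_deltaMove`;
  being the conjugate of, and proved equivalent to, the existing leaf `gompf2010_deltaMove`
  (`CappellShanesonFamilyStandardColumnMove.lean`), it was not an independent obligation and has
  been MERGED back: the constant is deleted, the theorem keeps the statement as its conclusion,
  and its users take `gompf2010_deltaMove`.)
* The proof of **Thm. 3.4** as printed, without number theory: base case `c ∈ {0, 1}` (`d = ±1`;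
  explicit conjugation to `A_{tr A - 2}` by `cZeroConj`, `signConj`), moves (i)/(ii), the descent
  on `|c|` (`exists_round`, `allSpheresStandard_of_c_mem_Icc`), both alternatives
  (`allSpheresStandard_of_modEq_sum`, `allSpheresStandard_of_modEq_d`),
  `gompf2010_theorem34_of_leaves` (the column move being derived from the row move;
  `gompf2010_theorem34_of_leaves'` is the same theorem, kept under its historical name).
* The proof of **Thm. 3.2**, first sentence (`allSpheresStandard_of_trace_mem_Icc`,
  `gompf2010_theorem32_of_leaves`) and of its last sentence from the first
  (`gompf2010_theorem32_d_of_theorem32`, Gompf's own window `[-6, 9]`).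
* **Cor. 3.5**: `gompf2010_corollary35_of_theorems` (from the named fact Thm. 3.2 and the
  statement of Thm. 3.4 — the printed dependency) and `gompf2010_corollary35_of_leaves` (the
  column move is not needed).

Named facts added in Part II: `aitchisonRubinstein1984_uniqueTraceClass_negSix_eleven` (Table 1
of [AR]: one class at traces `-6` and `11`, the row `(11, -6)`, discriminant `4729`; Gompf: "(see
[AR] for `r = -6, 11`)" — the trace `-6` is needed by the last inequality of Cor. 3.5, which says
`tr A ∉ [-6, 9]`); and Thm. 3.2 (first sentence) as printed (`gompf2010_theorem32`, with
the hypothesis "only one conjugacy class with trace `r`" as `CSTraceClassUnique r`) and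
its proof from the leaves (`gompf2010_theorem32_of_leaves`; the fact is kept so that users may take
it as a hypothesis). Thm. 3.4 as printed is NOT a named fact (it was one, `gompf2010_theorem34`,
until the D-0026/D-0027 review of 2026-08-15 merged it back: as a fact its discharge is exactly
the discharge of the two live geometric leaves of Cor. 3.5, so it carried no proof
obligation of its own); its statement is, verbatim, the common conclusion of the proved theorems
`gompf2010_theorem34_of_leaves`, `gompf2010_theorem34_of_leaves'` (section `Corollary35`),
`gompf2010_theorem34_of_deltaMove_of_familyStandard` and `gompf2010_theorem34_of_framedTwist_AK`
(Part IV). Everything is stated at one universe `u`: after a Δ-move `X ≅ X'` the sphere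
structure of `X'` is transported back to `X` (`IsCappellShanesonSphereOf.of_diffeomorph`), as in
Part I. Conjugations are in `SL(3, ℤ)` (`isConj_iff_exists_isUnit_det`); Gompf's sign change
`diag (1, -1, 1)` is `signConj = diag (-1, 1, -1)`.

Resulting DAG (all arrows proved): Cor. 3.5 `⇐ gompf2010_deltaMove ∧
gompf2010_akbulutKirby_framings ∧ akbulutKirby1979_sphere_four ∧
aitchisonRubinstein1984_uniqueTraceClass ∧ aitchisonRubinstein1984_traceNegFiveClasses ∧
aitchisonRubinstein1984_uniqueTraceClass_negSix_eleven` (the column move being the theorem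
`gompf2010_deltaMoveRight_of_deltaMove`); Cor. 3.5 outright is
`gompf2010_corollary35_of_leaves` applied
to the discharges. Deliberately NOT here: matrices not covered by Thms. 3.2/3.4 ("The author does
not presently know whether they cover all Cappell-Shaneson homotopy spheres").

## Part III — `CappellShanesonFamilyBarrier`: what the discharge of the family barrier amounts to

The third part (section `FamilyBarrier`, appended by the provefact unit of
`Literature.Barriers.SmoothPoincare4.CappellShanesonFamilyBarrier`) concerns the barrier for the
standard family itself, `CappellShanesonFamilyBarrier = ¬ ExoticCappellShanesonSphere (range
cappellShanesonMatrix)`: no Cappell–Shaneson sphere of any `Aₘ`, either framing, is exotic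
(Akbulut, Ann. of Math. 171 (2010), Thm. 1: "`Σₘ` is diffeomorphic to `S⁴`, for each `m ∈ ℤ`";
Gompf 2010, Examples 3.1(a): "Since `Aₘ` is in standard form with `d = 1`, we can change it to
have any trace, say `2`. The resulting matrix … must be conjugate to `A₀` … Since both homotopy
spheres arising from `A₀` are standard (by [AK1] for the untwisted framing and Theorem 4.3 …), the
result follows"; §1: for all `Aₘ` "the example with untwisted framing is standard" is [AR], the
twisted `m = 0` case is [AK2] with [Sig0] = Gompf, Topology 30 (1991), all twisted cases are
Akbulut [A]). Provefact triage
**XL**: the technique class quantifies over every closed smooth `X : Type` that is a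
Cappell–Shaneson sphere of some `Aₘ` in the sense of the tree's honest predicate (mapping torus,
section circle, tube, surgery gluing), so the discharge IS the tree's named fact
`nonempty_diffeomorph_sphere_four_of_isCappellShanesonSphereOf` closed over `X : Type`
(`cappellShanesonFamilyBarrier_iff_familyStandard`, proved) — nothing weaker suffices, and in
particular the barrier already contains [AK1] and Theorem 4.3 at `Type`
(`CappellShanesonFamilyBarrier.akbulutKirby1979_linearStraightening`, `….gompf2010_thm43`,
`….gompf2010_akbulutKirby_framings`). Proved here, sorry-free and without new definitions:

* the barrier **in concrete terms**: by the classification of Cappell–Shaneson spheres by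
  straightenings proved in the tree (`gompf2010_straightening_classification_holds`, Gompf §4 ¶2),
  `AllSpheresStandard A` is decided on Gompf's concrete spheres `X^σ_A = gompfSphere A γ`
  (`allSpheresStandard_iff_gompfSphere`), so the barrier holds iff every
  `gompfSphere (cappellShanesonMatrix m) γ` is `S⁴` (`cappellShanesonFamilyBarrier_iff_gompfSphere`)
  and the technique class is realised by these honest manifolds
  (`exoticCappellShanesonSphere_range_iff_gompfSphere`);
* **Examples 3.1(a) as a reduction to `A₀`**: the Δ-move `gompf2010_deltaMove` and "both spheres
  of `A₀` are standard" give the barrier (`cappellShanesonFamilyBarrier_of_deltaMove_of_akbulutKirby`;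
  the conjugation `E_m⁻¹ (Δ^{-m} Aₘ) E_m = A₀` is the tree's `gompfShear_inv_mul_mul_gompfShear`),
  hence the barrier from each recorded leaf set — `gompf2010_deltaMove ∧
  gompf2010_akbulutKirby_framings ∧ akbulutKirby1979_sphere_four` (`…_of_leaves`), the current
  geometric leaves **F**, **F₀**, [AK1]
  (`…_of_twist_AK`, everything else being proved in `GompfSectionCircleFramings.lean`), the framed
  Δ-move **F** with both concrete `A₀`-spheres standard (`…_of_framedTwist_of_gompfSphere`, the
  historical route [AK1] + [AK2]/[Sig0]), Thm. 3.2 (`…_of_theorem32_d`) and Kim–Yamada's trace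
  range with the Δ-move (`…_of_kimYamada`).

`CappellShanesonFamilyBarrier_holds` is `cappellShanesonFamilyBarrier_of_twist_AK hF hF₀ hAK` once
the three geometric leaves `gompf2010_framedTwist`, `gompf2010_framedTwistZero` (the framed
Theorem 2.1: fishtail neighbourhoods and Lemma 2.2) and `akbulutKirby1979_linearStraightening`
([AK1]: Kirby calculus) are discharged — the same leaves as for Parts I and II.

## References

* [GompfAGT2010] R. E. Gompf, Algebr. Geom. Topol. 10 (2010) 1665–1681, §3: Examples 3.1, Thm. 3.2,
  Lemma 3.3; Thm. 3.4, Cor. 3.5 and the two paragraphs after it, proof of Thm. 3.4 (Part II);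
  Thm. 2.1 and §3 ¶3 (the column move); §1 and §4 ¶2 (Part III).
* [Akbulut2010] S. Akbulut, *Cappell–Shaneson homotopy spheres are standard*, Ann. of Math. 171
  (2010) 2171–2175 (arXiv:0907.0136), Thm. 1 (Part III).
* [AkbulutKirby1979] S. Akbulut, R. Kirby, *An exotic involution of `S⁴`*, Topology 18 (1979)
  75–81 (Gompf 2010's [AK1]: the untwisted `A₀`-sphere is `S⁴`) (Part III).
* [AkbulutKirby1985] S. Akbulut, R. Kirby, *A potential smooth counterexample in dimension 4 to
  the Poincaré conjecture, the Schoenflies conjecture, and the Andrews–Curtis conjecture*, Topology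
  24 (1985) 375–390 (Gompf 2010's [AK2]: the handle diagram of the twisted `A₀`-sphere), §1 (Part III).
* [Gompf1991Killing] R. E. Gompf, *Killing the Akbulut–Kirby 4-sphere, with relevance to the
  Andrews–Curtis and Schoenflies problems*, Topology 30 (1991) 97–115 (Gompf 2010's [Sig0]: that
  diagram is `S⁴`), main theorem (Part III).
* [CappellShaneson1976] S. Cappell, J. Shaneson, *Some new four-manifolds*, Ann. of Math. 104
  (1976) 61–72, §2 (the construction; technique-class cite) (Part III).
* [AitchisonRubinstein1984] I. R. Aitchison, J. H. Rubinstein, Contemp. Math. 35 (1984) 1–74,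
  Appendix "Conjugacy in SL(3, ℤ)", Table 1, Example `a = -5`.
* [KimYamada2023] M. H. Kim, S. Yamada, Kyungpook Math. J. 63 (2023), Thm. B, Remark 1.1.
-/

noncomputable section

open scoped Manifold ContDiff
open Set Literature.Topology.FourManifolds

namespace Literature.Barriers.SmoothPoincare4

universe u

-- No local notation here (the sibling files write `𝔼 4`, `𝕊 4`): the model space is
-- `EuclideanSpace ℝ (Fin 4)` and the standard 4-sphere is
-- `Metric.sphere (0 : EuclideanSpace ℝ (Fin (4 + 1))) 1`, spelled out.
variable (X : Type u) [TopologicalSpace X] [T2Space X] [SecondCountableTopology X]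
  [ChartedSpace (EuclideanSpace ℝ (Fin 4)) X] [IsManifold (𝓡 4) ∞ X] [CompactSpace X]

/-- **One step of Gompf's method (§3, Examples 3.1): Δ-move, then conjugate into the family.**
If `A` is a Cappell–Shaneson matrix in standard form and some Δ-move `Δ ^ k * A` of it is
conjugate in `SL(3, ℤ)` to a family matrix `Aₘ`, then every Cappell–Shaneson sphere `X` of `A` is
diffeomorphic to `S⁴`: by `gompf2010_deltaMove`, `X ≅ X'` for a sphere `X'` of `Δ ^ k * A`, which
is a sphere of `Aₘ` (`IsCappellShanesonSphereOf.of_isConj`); transporting back along the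
diffeomorphism, `X` itself is a sphere of `Aₘ` (`IsCappellShanesonSphereOf.of_diffeomorph`), hence
standard by Examples 3.1(a) (`nonempty_diffeomorph_sphere_four_of_isCappellShanesonSphereOf_of`,
from the three topological leaves). [cite: GompfAGT2010, Examples 3.1 and Thm. 3.2 (proof)] -/
theorem nonempty_diffeomorph_sphere_four_of_isConj_gompfDelta_zpow_mul
    (hΔ : gompf2010_deltaMove.{u}) (h43 : gompf2010_akbulutKirby_framings.{0, 0})
    (hAK : akbulutKirby1979_sphere_four) {A : Matrix.SpecialLinearGroup (Fin 3) ℤ}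
    (hA : IsGompfStandardForm A) (hdet : ((A : Matrix (Fin 3) (Fin 3) ℤ) - 1).det = 1) (k m : ℤ)
    (hconj : IsConj (gompfDelta ^ k * A) (cappellShanesonMatrix m))
    (hX : IsCappellShanesonSphereOf A X) :
    Nonempty (X ≃ₘ⟮𝓡 4, 𝓡 4⟯ (Metric.sphere (0 : EuclideanSpace ℝ (Fin (4 + 1))) 1)) := by
  obtain ⟨X', _, _, _, _, _, _, hX', ⟨e⟩⟩ := hΔ A hA hdet k X hX
  exact nonempty_diffeomorph_sphere_four_of_isCappellShanesonSphereOf_of X hΔ h43 hAK m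
    ((hX'.of_isConj hconj).of_diffeomorph e.symm)

/-- **Examples 3.1(b), assembled: the spheres of Gompf's second trace-`-5` matrix `B` are
standard.** `B = gompfTraceNegFiveMatrix` is in standard form with `d = 3`, and `Δ² B` (trace `1`)
is conjugate to `A₋₁` by Gompf's explicit matrix
(`isConj_gompfDelta_sq_mul_gompfTraceNegFiveMatrix`), so the previous step applies with `k = 2`,
`m = -1` ("so the previous argument again shows that both associated homotopy spheres are
standard"). [cite: GompfAGT2010, Examples 3.1(b)] -/
theorem nonempty_diffeomorph_sphere_four_of_isCappellShanesonSphereOf_gompfTraceNegFiveMatrix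
    (hΔ : gompf2010_deltaMove.{u}) (h43 : gompf2010_akbulutKirby_framings.{0, 0})
    (hAK : akbulutKirby1979_sphere_four)
    (hX : IsCappellShanesonSphereOf gompfTraceNegFiveMatrix X) :
    Nonempty (X ≃ₘ⟮𝓡 4, 𝓡 4⟯ (Metric.sphere (0 : EuclideanSpace ℝ (Fin (4 + 1))) 1)) :=
  nonempty_diffeomorph_sphere_four_of_isConj_gompfDelta_zpow_mul X hΔ h43 hAK
    isGompfStandardForm_gompfTraceNegFiveMatrix det_gompfTraceNegFiveMatrix_sub_one 2 (-1)
    isConj_gompfDelta_sq_mul_gompfTraceNegFiveMatrix hX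

/-- **Gompf 2010, Thm. 3.2 (last sentence) — the assembly step, proved.** The named fact
`gompf2010_theorem32_d` (standard form, `det (A - I) = 1`, `|d| < 17` ⟹ every Cappell–Shaneson
sphere of `A` is `S⁴`) follows from the three topological leaves of Examples 3.1(a)
(`gompf2010_deltaMove`, `gompf2010_akbulutKirby_framings`, `akbulutKirby1979_sphere_four`) and the
two Aitchison–Rubinstein conjugacy-class facts, as printed: by Lemma 3.3 `d` is odd
(`IsGompfStandardForm.odd_apply_one_two`), so `|d| ≤ 15` and a Δ-move `A ↦ Δ ^ k * A` puts the
trace `tr A + k d` (`IsGompfStandardForm.trace_gompfDelta_zpow_mul`) into the window `[-5, 9]`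
(`exists_add_mul_mem_Icc_of_odd`), keeping standard form and `det (· - I) = 1`; if the new trace
is in `[-4, 9]` the matrix is conjugate to `A_{r-2}` ([AR]: unique class,
`aitchisonRubinstein1984_uniqueTraceClass.isConj_cappellShanesonMatrix`) and the spheres are
standard by Examples 3.1(a); if it is `-5`, the matrix is conjugate to `A₋₇` (same argument) or to
`B`, whose spheres are standard by Examples 3.1(b). When the five leaves are discharged,
`gompf2010_theorem32_d_holds` is this theorem applied to their proofs.
[cite: GompfAGT2010, Thm. 3.2 (proof)] -/
theorem gompf2010_theorem32_d_of (hΔ : gompf2010_deltaMove.{u})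
    (h43 : gompf2010_akbulutKirby_framings.{0, 0}) (hAK : akbulutKirby1979_sphere_four)
    (hAR : aitchisonRubinstein1984_uniqueTraceClass)
    (hAR5 : aitchisonRubinstein1984_traceNegFiveClasses) : gompf2010_theorem32_d.{u} := by
  intro A hA hdet hd X _ _ _ _ _ _ hX
  -- Lemma 3.3: `d` is odd; move the trace into `[-5, 9]` by a Δ-move
  obtain ⟨k, hk⟩ := exists_add_mul_mem_Icc_of_odd (hA.odd_apply_one_two hdet).1 hd
    (Matrix.trace (A : Matrix (Fin 3) (Fin 3) ℤ))
  have hdet' : (((gompfDelta ^ k * A : Matrix.SpecialLinearGroup (Fin 3) ℤ) :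
      Matrix (Fin 3) (Fin 3) ℤ) - 1).det = 1 := by
    rw [hA.det_gompfDelta_zpow_mul_sub_one]; exact hdet
  have htr' : Matrix.trace ((gompfDelta ^ k * A : Matrix.SpecialLinearGroup (Fin 3) ℤ) :
      Matrix (Fin 3) (Fin 3) ℤ) ∈ Set.Icc (-5 : ℤ) 9 := by
    rw [hA.trace_gompfDelta_zpow_mul]; exact hk
  by_cases h5 : Matrix.trace ((gompfDelta ^ k * A : Matrix.SpecialLinearGroup (Fin 3) ℤ) :
      Matrix (Fin 3) (Fin 3) ℤ) = -5
  · -- trace `-5`: two classes, `A₋₇` (Examples 3.1(a)) or `B` (Examples 3.1(b))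
    rcases hAR5.1 _ hdet' h5 with hc | hc
    · exact nonempty_diffeomorph_sphere_four_of_isConj_gompfDelta_zpow_mul X hΔ h43 hAK hA hdet
        k (-7) hc.symm hX
    · obtain ⟨X', _, _, _, _, _, _, hX', ⟨e⟩⟩ := hΔ A hA hdet k X hX
      exact nonempty_diffeomorph_sphere_four_of_isCappellShanesonSphereOf_gompfTraceNegFiveMatrix
        X hΔ h43 hAK ((hX'.of_isConj hc.symm).of_diffeomorph e.symm)
  · -- trace in `[-4, 9]`: unique class, conjugate to `A_{r-2}` (Examples 3.1(a))
    have htr4 : Matrix.trace ((gompfDelta ^ k * A : Matrix.SpecialLinearGroup (Fin 3) ℤ) :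
        Matrix (Fin 3) (Fin 3) ℤ) ∈ Set.Icc (-4 : ℤ) 9 := by
      simp only [Set.mem_Icc] at htr' ⊢
      omega
    exact nonempty_diffeomorph_sphere_four_of_isConj_gompfDelta_zpow_mul X hΔ h43 hAK hA hdet k _
      (hAR.isConj_cappellShanesonMatrix _ hdet' htr4).symm hX

/-- **The barrier for Gompf's class from the leaves**: `CappellShanesonSmallEntryBarrier` (no
Cappell–Shaneson sphere of a standard-form matrix with `det (A - 1) = 1` and `|d| < 17` is exotic)
follows from the five leaves, via `cappellShanesonSmallEntryBarrier_of_gompf`.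
[cite: GompfAGT2010, Thm. 3.2] -/
theorem cappellShanesonSmallEntryBarrier_of_leaves (hΔ : gompf2010_deltaMove.{0})
    (h43 : gompf2010_akbulutKirby_framings.{0, 0}) (hAK : akbulutKirby1979_sphere_four)
    (hAR : aitchisonRubinstein1984_uniqueTraceClass)
    (hAR5 : aitchisonRubinstein1984_traceNegFiveClasses) : CappellShanesonSmallEntryBarrier :=
  cappellShanesonSmallEntryBarrier_of_gompf (gompf2010_theorem32_d_of hΔ h43 hAK hAR hAR5)

/-- **Thm. 3.2 (last sentence) from Kim–Yamada's trace range and the Δ-move alone.** A shorter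
reduction through the tree's named fact
`kimYamada2023_nonempty_diffeomorph_sphere_four_of_trace_mem_Icc` (Kim–Yamada 2023, Thm. B with
Remark 1.1: every Cappell–Shaneson sphere of a matrix with `det (A - I) = 1` and trace in
`[-64, 69]` is `S⁴`; their proof itself runs through Gompf's §3): since `d` is odd (Lemma 3.3), a
Δ-move puts the trace into `[-5, 9] ⊆ [-64, 69]`. [cite: KimYamada2023, Thm. B and Remark 1.1] -/
theorem gompf2010_theorem32_d_of_kimYamada (hΔ : gompf2010_deltaMove.{u})
    (hKY : kimYamada2023_nonempty_diffeomorph_sphere_four_of_trace_mem_Icc.{0}) :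
    gompf2010_theorem32_d.{u} := by
  intro A hA hdet hd X _ _ _ _ _ _ hX
  obtain ⟨k, hk⟩ := exists_add_mul_mem_Icc_of_odd (hA.odd_apply_one_two hdet).1 hd
    (Matrix.trace (A : Matrix (Fin 3) (Fin 3) ℤ))
  obtain ⟨X', _, _, _, _, _, _, hX', ⟨e⟩⟩ := hΔ A hA hdet k X hX
  have hdet' : (((gompfDelta ^ k * A : Matrix.SpecialLinearGroup (Fin 3) ℤ) :
      Matrix (Fin 3) (Fin 3) ℤ) - 1).det = 1 := by
    rw [hA.det_gompfDelta_zpow_mul_sub_one]; exact hdet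
  have htr' : Matrix.trace ((gompfDelta ^ k * A : Matrix.SpecialLinearGroup (Fin 3) ℤ) :
      Matrix (Fin 3) (Fin 3) ℤ) ∈ Set.Icc (-64 : ℤ) 69 := by
    rw [hA.trace_gompfDelta_zpow_mul]
    simp only [Set.mem_Icc] at hk ⊢
    omega
  obtain ⟨e'⟩ := hKY (gompfDelta ^ k * A) hdet' htr' X' hX'
  exact ⟨e.trans e'⟩

end Literature.Barriers.SmoothPoincare4

/-! ## Part II — Gompf 2010, Cor. 3.5 from the leaves -/

namespace Literature.Barriers.SmoothPoincare4

universe u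

open scoped MatrixGroups

/-! ### More matrix algebra of Cappell–Shaneson matrices in standard form -/

section Algebra

variable {A : SL(3, ℤ)}

/-- **`(a + c e) d = c (c - 1)(f - 1) + 1`** for a Cappell–Shaneson matrix in standard form
`!![0, a, b; 0, c, d; 1, e, f]` (Gompf 2010, after Cor. 3.5: "all Cappell-Shaneson matrices in
standard form correspond bijectively to triples `c, e, f` and factorizations
`(a + ce) d = c(c-1)(f-1) + 1`"), from `a d - b c = 1` and `b = (c - 1)(f - 1) - d e`.
[cite: GompfAGT2010, §3 (paragraph after Cor. 3.5)] -/
theorem key_eq_of_isGompfStandardForm (hA : IsGompfStandardForm A) (hdet : (A.1 - 1).det = 1) :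
    (A.1 0 1 + A.1 1 1 * A.1 2 1) * A.1 1 2 = A.1 1 1 * (A.1 1 1 - 1) * (A.1 2 2 - 1) + 1 := by
  have h1 := A.2
  rw [hA.det_coe_eq] at h1
  have h2 := hA.apply_zero_two_eq hdet
  linear_combination h1 + A.1 1 1 * h2

/-- **`a + c e` is odd** (and so is `d`) for a Cappell–Shaneson matrix in standard form, since
`(a + ce) d = c(c-1)(f-1) + 1` is odd ("the proof below … also implicitly shows `a + ce` is odd";
Lemma 3.3 for `d`). [cite: GompfAGT2010, Lemma 3.3 and §3 (paragraph after Cor. 3.5)] -/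
theorem odd_of_isGompfStandardForm (hA : IsGompfStandardForm A) (hdet : (A.1 - 1).det = 1) :
    Odd (A.1 0 1 + A.1 1 1 * A.1 2 1) ∧ Odd (A.1 1 2) := by
  have hodd : Odd ((A.1 0 1 + A.1 1 1 * A.1 2 1) * A.1 1 2) := by
    rw [key_eq_of_isGompfStandardForm hA hdet]
    exact ((Int.even_mul_pred_self _).mul_right _).add_one
  exact Int.odd_mul.1 hodd

/-- The trace of a matrix in standard form is `c + f`. [cite: GompfAGT2010, §3 (standard form)] -/
theorem trace_of_isGompfStandardForm (hA : IsGompfStandardForm A) :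
    A.1.trace = A.1 1 1 + A.1 2 2 := by
  rw [Matrix.trace_fin_three, hA.1, zero_add]

/-- **Residue windows.** A window of `hi - lo + 1 ≥ |n|` consecutive integers meets every residue
class modulo `n ≠ 0`: some `t + k n` lies in `[lo, hi]` (used with `n = d`, `a + ce`, `c(c-1)`,
`a`). [folklore] -/
theorem exists_add_mul_mem_Icc (t lo hi : ℤ) {n : ℤ} (hn : n ≠ 0) (hlen : |n| ≤ hi - lo + 1) :
    ∃ k : ℤ, t + k * n ∈ Icc lo hi := by
  refine ⟨-((t - lo) / n), ?_⟩
  have h1 := Int.emod_nonneg (t - lo) hn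
  have h2 := Int.emod_lt_abs (t - lo) hn
  have h3 := Int.ediv_mul_add_emod (t - lo) n
  have h4 : t + -((t - lo) / n) * n = lo + (t - lo) % n := by linear_combination -h3
  rw [h4, mem_Icc]
  constructor <;> linarith

/-- **Entries of the row move** `Δᵏ A`: rows `0` and `2` become `row₀ - k row₁` and
`row₂ + k row₁` ("adding any multiple of the second row to the third while subtracting the same
multiple from the first"); for `A = !![0, a, b; 0, c, d; 1, e, f]`,
`Δᵏ A = !![0, a - kc, b - kd; 0, c, d; 1, e + kc, f + kd]`. [cite: GompfAGT2010, §3 (the matrix Δ)] -/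
theorem entries_gompfDelta_zpow_mul (k : ℤ) (A : SL(3, ℤ)) :
    (gompfDelta ^ k * A).1 0 1 = A.1 0 1 - k * A.1 1 1 ∧
    (gompfDelta ^ k * A).1 1 1 = A.1 1 1 ∧ (gompfDelta ^ k * A).1 1 2 = A.1 1 2 ∧
    (gompfDelta ^ k * A).1 2 1 = A.1 2 1 + k * A.1 1 1 ∧
    (gompfDelta ^ k * A).1 2 2 = A.1 2 2 + k * A.1 1 2 := by
  simp only [Matrix.SpecialLinearGroup.coe_mul, coe_gompfDelta_zpow]
  refine ⟨?_, ?_, ?_, ?_, ?_⟩ <;> simp [Matrix.mul_apply, Fin.sum_univ_three] <;> ring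

/-- **Entries of the column move** `A Δᵏ`: the second column becomes `col₁ - k col₀ + k col₂`,
the others are unchanged ("the conjugate operation on the second column"; for `A` in standard
form `c ↦ c + kd`, "change `c` and `f` by independent multiples of `d`"). [cite: GompfAGT2010, §3 (the matrix Δ)] -/
theorem entries_mul_gompfDelta_zpow (k : ℤ) (A : SL(3, ℤ)) :
    (A * gompfDelta ^ k).1 0 1 = A.1 0 1 - k * A.1 0 0 + k * A.1 0 2 ∧
    (A * gompfDelta ^ k).1 1 1 = A.1 1 1 - k * A.1 1 0 + k * A.1 1 2 ∧
    (A * gompfDelta ^ k).1 2 1 = A.1 2 1 - k * A.1 2 0 + k * A.1 2 2 ∧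
    (A * gompfDelta ^ k).1 1 2 = A.1 1 2 ∧ (A * gompfDelta ^ k).1 2 2 = A.1 2 2 := by
  simp only [Matrix.SpecialLinearGroup.coe_mul, coe_gompfDelta_zpow]
  refine ⟨?_, ?_, ?_, ?_, ?_⟩ <;> simp [Matrix.mul_apply, Fin.sum_univ_three] <;> ring

/-- **Column moves preserve the Cappell–Shaneson condition**: for `A` in standard form,
`det (A Δᵏ - 1) = det (A - 1)` ("`B` is also a Cappell-Shaneson matrix", Gompf 2010, §4; the
polynomial `b - (c - 1)(f - 1) + d e` is unchanged under
`(a, c, e) ↦ (a + kb, c + kd, e + k(f - 1))`). The row version is the tree's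
`IsGompfStandardForm.det_gompfDelta_zpow_mul_sub_one`. [cite: GompfAGT2010, §§3–4 (Δ-moves preserve Cappell–Shaneson matrices)] -/
theorem det_mul_gompfDelta_zpow_sub_one (hA : IsGompfStandardForm A) (k : ℤ) :
    ((A * gompfDelta ^ k).1 - 1).det = (A.1 - 1).det := by
  obtain ⟨h0, h1, h2⟩ := hA
  simp only [Matrix.SpecialLinearGroup.coe_mul, coe_gompfDelta_zpow, Matrix.det_fin_three,
    Matrix.sub_apply, Matrix.mul_apply, Fin.sum_univ_three, Matrix.one_apply, h0, h1, h2]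
  simp
  ring

/-- **Conjugation by the shear `E_m = gompfShear m`** resets `e`: for
`A = !![0, a, b; 0, c, d; 1, e, f]` in standard form,
`E_m A E_m⁻¹ = !![0, a + mc, b + md; 0, c, d; 1, e - m, f]` ("It suffices to assume `e = 0`,
after subtracting `e` times the first column from the second, and the corresponding row operation
that replaces `a` by `a + ce`", proof of Thm. 3.4, `m = e`). [cite: GompfAGT2010, Thm. 3.4 (proof)] -/
theorem entries_shear_conj (hA : IsGompfStandardForm A) (m : ℤ) :
    IsGompfStandardForm (gompfShear m * A * (gompfShear m)⁻¹) ∧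
    (gompfShear m * A * (gompfShear m)⁻¹).1 0 1 = A.1 0 1 + m * A.1 1 1 ∧
    (gompfShear m * A * (gompfShear m)⁻¹).1 1 1 = A.1 1 1 ∧
    (gompfShear m * A * (gompfShear m)⁻¹).1 1 2 = A.1 1 2 ∧
    (gompfShear m * A * (gompfShear m)⁻¹).1 2 1 = A.1 2 1 - m ∧
    (gompfShear m * A * (gompfShear m)⁻¹).1 2 2 = A.1 2 2 := by
  obtain ⟨h0, h1, h2⟩ := hA
  simp only [IsGompfStandardForm, Matrix.SpecialLinearGroup.coe_mul,
    Matrix.SpecialLinearGroup.coe_inv, coe_gompfShear, Matrix.adjugate_fin_three_of]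
  refine ⟨⟨?_, ?_, ?_⟩, ?_, ?_, ?_, ?_, ?_⟩ <;>
    simp [Matrix.mul_apply, Matrix.vecMul, dotProduct, Fin.sum_univ_three, h0, h1, h2]
  ring

/-- **The conjugating matrix of move (i)** in the proof of Thm. 3.4 (for `A` with `e = 0`):
`P = !![1, 0, ka; k, 1, k(c + ka); 0, 0, 1] ∈ SL(3, ℤ)`, the product of "add `k` times the first
row to the second, with the corresponding column operation" and the two row operations, with
their column operations affecting only the third column, that reset the first column to `e₃`.
[cite: GompfAGT2010, Thm. 3.4 (proof, move (i))] -/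
def moveOneConj (A : SL(3, ℤ)) (k : ℤ) : SL(3, ℤ) :=
  ⟨!![1, 0, k * A.1 0 1; k, 1, k * (A.1 1 1 + k * A.1 0 1); 0, 0, 1], by
    simp [Matrix.det_fin_three]⟩

/-- **Move (i)**: for `A` in standard form with `e = 0`, conjugation by `moveOneConj A k` keeps
standard form, `e = 0` and `a`, and replaces `c` by `c + ka` ("we can change the pair `(a, c)` to
either (i) `(a, c + ka)` …"). [cite: GompfAGT2010, Thm. 3.4 (proof, move (i))] -/
theorem entries_moveOne_conj (hA : IsGompfStandardForm A) (he : A.1 2 1 = 0) (k : ℤ) :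
    IsGompfStandardForm (moveOneConj A k * A * (moveOneConj A k)⁻¹) ∧
    (moveOneConj A k * A * (moveOneConj A k)⁻¹).1 0 1 = A.1 0 1 ∧
    (moveOneConj A k * A * (moveOneConj A k)⁻¹).1 1 1 = A.1 1 1 + k * A.1 0 1 ∧
    (moveOneConj A k * A * (moveOneConj A k)⁻¹).1 2 1 = 0 := by
  obtain ⟨h0, h1, h2⟩ := hA
  simp only [IsGompfStandardForm, moveOneConj, Matrix.SpecialLinearGroup.coe_mul,
    Matrix.SpecialLinearGroup.coe_inv, Matrix.adjugate_fin_three_of]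
  refine ⟨⟨?_, ?_, ?_⟩, ?_, ?_, ?_⟩ <;>
    simp [Matrix.mul_apply, Matrix.vecMul, dotProduct, Fin.sum_univ_three, h0, h1, h2, he] <;>
    ring

/-- The sign change `D = diag (-1, 1, -1) ∈ SL(3, ℤ)` of the middle row and column ("after we
possibly reverse the signs of the middle row and column", proof of Thm. 3.4; as an element of
`SL(3, ℤ)` rather than `diag (1, -1, 1) ∈ GL(3, ℤ)`, with the same conjugation action).
[cite: GompfAGT2010, Thm. 3.4 (proof)] -/
def signConj : SL(3, ℤ) :=
  ⟨!![-1, 0, 0; 0, 1, 0; 0, 0, -1], by decide⟩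

/-- The conjugating matrix `!![1, f - 1, 0; 0, 1, 0; 0, -1, 1] ∈ SL(3, ℤ)` taking
`!![0, 1, 1 - f; 0, 0, 1; 1, 0, f]` (standard form, `c = e = 0`, `a = d = 1`) to `A_{f-2}` ("reduce
to some `A_m` by hand", proof of Thm. 3.4, the case `c(c-1) = 0`): `e₁` is a cyclic vector of a
standard-form matrix exactly when `d = ±1`, so both sides are conjugate to the companion matrix of
the Cappell–Shaneson polynomial of trace `f` (Aitchison–Rubinstein 1984, Appendix, the
conjugations to rational canonical form). [cite: GompfAGT2010, Thm. 3.4 (proof)] -/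
def cZeroConj (f : ℤ) : SL(3, ℤ) :=
  ⟨!![1, f - 1, 0; 0, 1, 0; 0, -1, 1], by simp [Matrix.det_fin_three]⟩

end Algebra

/-! ### "Both homotopy spheres associated to `A` are diffeomorphic to `S⁴`" -/

section Standard

/-- **"Both homotopy spheres associated to `A` are diffeomorphic to `S⁴`"** (the conclusion of
Thms. 3.2 and 3.4), framing-free as everywhere in the tree: every closed smooth 4-manifold
`X : Type u` that is a Cappell–Shaneson sphere of `A` (`IsCappellShanesonSphereOf A X`, either
framing) is diffeomorphic to `S⁴`. For `𝒜 = {A}` at `Type` this is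
`¬ ExoticCappellShanesonSphere {A}`. [cite: GompfAGT2010, Thm. 3.2] -/
def AllSpheresStandard (A : SL(3, ℤ)) : Prop :=
  ∀ (X : Type u) [TopologicalSpace X] [T2Space X] [SecondCountableTopology X]
    [ChartedSpace (EuclideanSpace ℝ (Fin 4)) X] [IsManifold (𝓡 4) ∞ X] [CompactSpace X],
    IsCappellShanesonSphereOf A X →
      Nonempty (X ≃ₘ⟮𝓡 4, 𝓡 4⟯ (Metric.sphere (0 : EuclideanSpace ℝ (Fin (4 + 1))) 1))

/-- **The family `Aₘ` is standard** — the tree's named fact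
`Literature.Topology.FourManifolds.nonempty_diffeomorph_sphere_four_of_isCappellShanesonSphereOf X`
closed over all closed smooth `X : Type u` (Gompf 2010, Examples 3.1(a); Akbulut 2010).
[cite: GompfAGT2010, Examples 3.1(a)] -/
def FamilyStandard : Prop :=
  ∀ (X : Type u) [TopologicalSpace X] [T2Space X] [SecondCountableTopology X]
    [ChartedSpace (EuclideanSpace ℝ (Fin 4)) X] [IsManifold (𝓡 4) ∞ X] [CompactSpace X],
    nonempty_diffeomorph_sphere_four_of_isCappellShanesonSphereOf X

/-- `FamilyStandard` from the three leaves of `CappellShanesonGompfReduction.lean` (Thm. 2.1/§3,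
Thm. 4.3, [AK1]): the tree's assembly
`nonempty_diffeomorph_sphere_four_of_isCappellShanesonSphereOf_of`. [cite: GompfAGT2010, Examples 3.1(a)] -/
theorem familyStandard_of_leaves (hΔ : gompf2010_deltaMove.{u})
    (h43 : gompf2010_akbulutKirby_framings.{0, 0}) (hAK : akbulutKirby1979_sphere_four) :
    FamilyStandard.{u} := fun X _ _ _ _ _ _ =>
  nonempty_diffeomorph_sphere_four_of_isCappellShanesonSphereOf_of X hΔ h43 hAK

/-- Every Cappell–Shaneson sphere of `Aₘ` is standard, given `FamilyStandard`. [cite: GompfAGT2010, Examples 3.1(a)] -/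
theorem allSpheresStandard_cappellShanesonMatrix (hAm : FamilyStandard.{u}) (m : ℤ) :
    AllSpheresStandard.{u} (cappellShanesonMatrix m) := fun X _ _ _ _ _ _ hX => hAm X m hX

/-- **Conjugation invariance**: conjugate matrices have the same spheres ("This pair only depends
on the conjugacy class of `A`"; `IsCappellShanesonSphereOf.of_isConj`). [cite: GompfAGT2010, §3 (conjugacy invariance)] -/
theorem allSpheresStandard_congr_isConj {A B : SL(3, ℤ)} (h : IsConj A B) :
    AllSpheresStandard.{u} A ↔ AllSpheresStandard.{u} B :=
  ⟨fun hs X _ _ _ _ _ _ hX => hs X (hX.of_isConj h.symm),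
    fun hs X _ _ _ _ _ _ hX => hs X (hX.of_isConj h)⟩

/-- Conjugation invariance in the form `P A P⁻¹`. [cite: GompfAGT2010, §3 (conjugacy invariance)] -/
theorem allSpheresStandard_conj_iff (A P : SL(3, ℤ)) :
    AllSpheresStandard.{u} (P * A * P⁻¹) ↔ AllSpheresStandard.{u} A :=
  (allSpheresStandard_congr_isConj (isConj_iff.2 ⟨P, rfl⟩)).symm

/-- **Row Δ-moves transfer standardness**: under `gompf2010_deltaMove`, if the spheres of `Δᵏ A`
are standard then so are those of `A` (`A` a Cappell–Shaneson matrix in standard form): a sphere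
`X` of `A` is diffeomorphic to a sphere `X'` of `Δᵏ A`, so `X` itself is a sphere of `Δᵏ A`
(`IsCappellShanesonSphereOf.of_diffeomorph`). [cite: GompfAGT2010, Thm 2.1 and §3 (Δ-moves on matrices in standard form)] -/
theorem allSpheresStandard_of_deltaMove (hΔ : gompf2010_deltaMove.{u}) {A : SL(3, ℤ)}
    (hA : IsGompfStandardForm A) (hdet : (A.1 - 1).det = 1) (k : ℤ)
    (h : AllSpheresStandard.{u} (gompfDelta ^ k * A)) : AllSpheresStandard.{u} A := by
  intro X _ _ _ _ _ _ hX
  obtain ⟨X', _, _, _, _, _, _, hX', ⟨e⟩⟩ := hΔ A hA hdet k X hX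
  exact h X (hX'.of_diffeomorph e.symm)

end Standard

/-! ### The column move from Theorem 2.1 on the torus -/

section ColumnMove

/-- **Gompf 2010, Theorem 2.1 in the Cappell–Shaneson setting, column version (§3 ¶3): the move
`A ↦ A Δᵏ` does not change the Cappell–Shaneson spheres — PROVED from the row move
`Literature.Topology.FourManifolds.gompf2010_deltaMove`.** For `A ∈ SL(3, ℤ)` with
`det (A - 1) = 1` in standard form, Theorem 2.1 (`X^ε_{φ∘δᵏ} = X^ε_φ = X^ε_{δᵏ∘φ}`) with `δ`
isotopic to `Δ` "allows us to change `A` (in standard form) by adding any multiple of the second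
row to the third while subtracting the same multiple from the first, or by the conjugate
operation on the second column [`A ↦ A Δᵏ`], without changing the resulting pair of
diffeomorphism types"; framing-free rendering as for the row move: every Cappell–Shaneson sphere
`X : Type u` of `A` is diffeomorphic to one, `X' : Type`, of `A * gompfDelta ^ k`. Proof (§3 ¶3:
"the conjugate operation"; §3 ¶1: conjugate matrices give the same pair of spheres): a
Cappell–Shaneson sphere `X` of `A` is diffeomorphic, by the row move
`gompf2010_deltaMove`, to a sphere `X'` of `Δᵏ A`; since `A Δᵏ = A (Δᵏ A) A⁻¹`, the surgered
mapping torus `X'` of the linear monodromy `Δᵏ A` is one of `A Δᵏ` — same manifold, same mapping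
torus, the fibre coordinates changed by the based diffeomorphism `torusDiffeomorph A`
(`IsSurgeredMappingTorusOf.torusDiffeomorph_mul_comm`, `CappellShanesonDeltaMove.lean`) — and
`det (A Δᵏ - 1) = det (A - 1)`. (History, D-0026/D-0027: this statement was at first also minted
as a separate named fact of this file; it is the conjugate of — and was proved equivalent to —
the row move, `CappellShanesonFamilyStandardColumnMove.lean`, hence not an independent proof
obligation, and that constant has been merged back into this theorem, 2026-08-15. The single
geometric obligation behind row and column moves is Theorem 2.1 proper in its framed form,
`Literature.Topology.FourManifolds.gompf2010_framedTwist`.) [cite: GompfAGT2010, Thm 2.1 and §3 ¶1, ¶3 (Δ-moves on matrices in standard form; the conjugate operation on the second column)] -/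
theorem gompf2010_deltaMoveRight_of_deltaMove (hΔ : gompf2010_deltaMove.{u}) :
    ∀ (A : SL(3, ℤ)) (_ : IsGompfStandardForm A) (_ : (A.1 - 1).det = 1) (k : ℤ)
      (X : Type u) [TopologicalSpace X] [T2Space X] [SecondCountableTopology X]
      [ChartedSpace (EuclideanSpace ℝ (Fin 4)) X] [IsManifold (𝓡 4) ∞ X] [CompactSpace X],
      IsCappellShanesonSphereOf A X →
        ∃ (X' : Type) (_ : TopologicalSpace X') (_ : T2Space X') (_ : SecondCountableTopology X')
          (_ : ChartedSpace (EuclideanSpace ℝ (Fin 4)) X') (_ : IsManifold (𝓡 4) ∞ X')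
          (_ : CompactSpace X'),
          IsCappellShanesonSphereOf (A * gompfDelta ^ k) X' ∧ Nonempty (X ≃ₘ⟮𝓡 4, 𝓡 4⟯ X') := by
  intro A hA hdet k X _ _ _ _ _ _ hX
  obtain ⟨X', _, _, _, _, _, _, h', e⟩ := hΔ A hA hdet k X hX
  refine ⟨X', ‹_›, ‹_›, ‹_›, ‹_›, ‹_›, ‹_›, ?_, e⟩
  exact h'.isSurgeredMappingTorusOf.torusDiffeomorph_mul_comm.isCappellShanesonSphereOf
    (Or.inl (by rw [det_mul_gompfDelta_zpow_sub_one hA]; exact hdet))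

/-- **Column Δ-moves transfer standardness** (as `allSpheresStandard_of_deltaMove`): under the
row move `gompf2010_deltaMove` (hence the column move, `gompf2010_deltaMoveRight_of_deltaMove`),
if the spheres of `A Δᵏ` are standard then so are those of `A`. [cite: GompfAGT2010, Thm 2.1 and §3 ¶3 (Δ-moves on matrices in standard form)] -/
theorem allSpheresStandard_of_deltaMoveRight (hΔ : gompf2010_deltaMove.{u}) {A : SL(3, ℤ)}
    (hA : IsGompfStandardForm A) (hdet : (A.1 - 1).det = 1) (k : ℤ)
    (h : AllSpheresStandard.{u} (A * gompfDelta ^ k)) : AllSpheresStandard.{u} A := by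
  intro X _ _ _ _ _ _ hX
  obtain ⟨X', _, _, _, _, _, _, hX', ⟨e⟩⟩ := gompf2010_deltaMoveRight_of_deltaMove hΔ A hA hdet k X hX
  exact h X (hX'.of_diffeomorph e.symm)

end ColumnMove

/-! ### Theorem 3.4: the descent on `(a, c)` -/

section Theorem34

variable {A : SL(3, ℤ)}

/-- **Base case of Thm. 3.4** (`c (c - 1) = 0`): a Cappell–Shaneson matrix in standard form with
`e = 0` and `c ∈ {0, 1}` has `a d = 1`, hence `a = d = ±1`, and is conjugate in `SL(3, ℤ)` to
`A_{tr A - 2}` ("this case is easy, since `c = 1` implies `b = (c-1)(f-1) = 0`, and `b` or `c = 0`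
implies `ad = ad - bc = 1`, so `d = ±1`. We can now … reduce to some `A_m` by hand. (In fact, when
`c = 1`, `A` is already forced to be `A_{f-1}`, after we possibly reverse the signs of the middle
row and column.)"; for `c = 0` the conjugation is `cZeroConj f`, after `signConj` if `a = d = -1`).
Hence its spheres are standard, given `FamilyStandard`. [cite: GompfAGT2010, Thm. 3.4 (proof, the case c(c-1) = 0)] -/
theorem allSpheresStandard_of_c_eq_zero_or_one (hAm : FamilyStandard.{u})
    (hA : IsGompfStandardForm A) (hdet : (A.1 - 1).det = 1) (he : A.1 2 1 = 0)
    (hc : A.1 1 1 = 0 ∨ A.1 1 1 = 1) : AllSpheresStandard.{u} A := by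
  obtain ⟨h0, h1, h2⟩ := hA
  have had := A.2
  rw [IsGompfStandardForm.det_coe_eq ⟨h0, h1, h2⟩] at had
  have hb := IsGompfStandardForm.apply_zero_two_eq ⟨h0, h1, h2⟩ hdet
  rw [he, mul_zero, sub_zero] at hb
  rcases hc with hc | hc
  · -- `c = 0`: `b = 1 - f`, `a d = 1`
    rw [hc, mul_zero, sub_zero] at had
    rw [hc, zero_sub, neg_one_mul, neg_sub] at hb
    rcases Int.eq_one_or_neg_one_of_mul_eq_one' had with ⟨ha, hd⟩ | ⟨ha, hd⟩
    · -- `A = !![0, 1, 1 - f; 0, 0, 1; 1, 0, f]`, conjugate by `cZeroConj f` to `A_{f-2}`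
      rw [← allSpheresStandard_conj_iff A (cZeroConj (A.1 2 2))]
      convert allSpheresStandard_cappellShanesonMatrix hAm (A.1 2 2 - 2) using 1
      refine Subtype.ext (Matrix.ext fun i j => ?_)
      simp only [cZeroConj, Matrix.SpecialLinearGroup.coe_mul, Matrix.SpecialLinearGroup.coe_inv,
        Matrix.adjugate_fin_three_of, coe_cappellShanesonMatrix]
      fin_cases i <;> fin_cases j <;>
        simp [Matrix.mul_apply, Matrix.vecMul, dotProduct, Fin.sum_univ_three, h0, h1, h2, he,
          hc, ha, hb, hd]
      ring
    · -- first reverse the signs of the middle row and column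
      rw [← allSpheresStandard_conj_iff A (cZeroConj (A.1 2 2) * signConj)]
      convert allSpheresStandard_cappellShanesonMatrix hAm (A.1 2 2 - 2) using 1
      refine Subtype.ext (Matrix.ext fun i j => ?_)
      simp only [cZeroConj, signConj, Matrix.SpecialLinearGroup.coe_mul,
        Matrix.SpecialLinearGroup.coe_inv, Matrix.adjugate_fin_three, coe_cappellShanesonMatrix]
      fin_cases i <;> fin_cases j <;>
        simp [Matrix.mul_apply, Matrix.vecMul, dotProduct, Fin.sum_univ_three, h0, h1, h2, he,
          hc, ha, hb, hd] <;> ring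
  · -- `c = 1`: `b = 0`, `a d = 1`
    rw [hc, sub_self, zero_mul] at hb
    rw [hb, zero_mul, sub_zero] at had
    rcases Int.eq_one_or_neg_one_of_mul_eq_one' had with ⟨ha, hd⟩ | ⟨ha, hd⟩
    · -- `A = A_{f-1}` on the nose
      convert allSpheresStandard_cappellShanesonMatrix hAm (A.1 2 2 - 1) using 1
      refine Subtype.ext (Matrix.ext fun i j => ?_)
      simp only [coe_cappellShanesonMatrix]
      fin_cases i <;> fin_cases j <;> simp [h0, h1, h2, he, hc, ha, hb, hd]
    · rw [← allSpheresStandard_conj_iff A signConj]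
      convert allSpheresStandard_cappellShanesonMatrix hAm (A.1 2 2 - 1) using 1
      refine Subtype.ext (Matrix.ext fun i j => ?_)
      simp only [signConj, Matrix.SpecialLinearGroup.coe_mul, Matrix.SpecialLinearGroup.coe_inv,
        Matrix.adjugate_fin_three_of, coe_cappellShanesonMatrix]
      fin_cases i <;> fin_cases j <;>
        simp [Matrix.mul_apply, Matrix.vecMul, dotProduct, Fin.sum_univ_three, h0, h1, h2, he,
          hc, ha, hb, hd]

/-- **Move (ii) followed by resetting `e`** ("use the new move to subtract `k` times the second
row from the first, replacing `a` by `a - kc` and `e = 0` by `kc`. Resetting `e` to `0` as before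
completes the process"): from `A` in standard form with `e = 0`, the matrix
`E_{kc} (Δᵏ A) E_{kc}⁻¹` is in standard form with `e = 0`, the same `c`, `d`, and
`a ↦ a + k c (c - 1)`; standardness transfers back along the move. [cite: GompfAGT2010, Thm. 3.4 (proof, move (ii))] -/
theorem exists_moveTwo (hΔ : gompf2010_deltaMove.{u}) (hA : IsGompfStandardForm A)
    (hdet : (A.1 - 1).det = 1) (he : A.1 2 1 = 0) (k : ℤ) :
    ∃ B : SL(3, ℤ), IsGompfStandardForm B ∧ (B.1 - 1).det = 1 ∧ B.1 2 1 = 0 ∧ B.1 1 1 = A.1 1 1 ∧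
      B.1 1 2 = A.1 1 2 ∧ B.1 0 1 = A.1 0 1 + k * (A.1 1 1 * (A.1 1 1 - 1)) ∧
      (AllSpheresStandard.{u} B → AllSpheresStandard.{u} A) := by
  have hsf₁ : IsGompfStandardForm (gompfDelta ^ k * A) := hA.gompfDelta_zpow_mul k
  have hdet₁ : ((gompfDelta ^ k * A).1 - 1).det = 1 := by
    rw [hA.det_gompfDelta_zpow_mul_sub_one]; exact hdet
  obtain ⟨ha₁, hc₁, hd₁, he₁, -⟩ := entries_gompfDelta_zpow_mul k A
  obtain ⟨hsf, ha, hc, hd, he', -⟩ := entries_shear_conj hsf₁ (k * A.1 1 1)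
  refine ⟨gompfShear (k * A.1 1 1) * (gompfDelta ^ k * A) * (gompfShear (k * A.1 1 1))⁻¹, hsf,
    ?_, ?_, ?_, ?_, ?_, fun h => ?_⟩
  · rw [det_coe_conj_sub_one]; exact hdet₁
  · rw [he', he₁, he]; ring
  · rw [hc, hc₁]
  · rw [hd, hd₁]
  · rw [ha, ha₁, hc₁]; ring
  · exact allSpheresStandard_of_deltaMove hΔ hA hdet k ((allSpheresStandard_conj_iff _ _).1 h)

/-- **Move (i) as an existence statement**: from `A` in standard form with `e = 0`, for every `k`
there is an `SL(3, ℤ)`-conjugate in standard form with `e = 0`, the same `a`, and `c ↦ c + ka`;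
standardness is unchanged. [cite: GompfAGT2010, Thm. 3.4 (proof, move (i))] -/
theorem exists_moveOne (hA : IsGompfStandardForm A) (hdet : (A.1 - 1).det = 1) (he : A.1 2 1 = 0)
    (k : ℤ) :
    ∃ B : SL(3, ℤ), IsGompfStandardForm B ∧ (B.1 - 1).det = 1 ∧ B.1 2 1 = 0 ∧ B.1 0 1 = A.1 0 1 ∧
      B.1 1 1 = A.1 1 1 + k * A.1 0 1 ∧ (AllSpheresStandard.{u} B ↔ AllSpheresStandard.{u} A) := by
  obtain ⟨hsf, ha, hc, he'⟩ := entries_moveOne_conj hA he k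
  exact ⟨_, hsf, by rw [det_coe_conj_sub_one]; exact hdet, he', ha, hc,
    allSpheresStandard_conj_iff _ _⟩

/-- **One round of the descent** in the proof of Thm. 3.4: for `A` in standard form with `e = 0`
and `c ∈ [-3, 4] ∖ {0, 1}`, move (ii) makes `a` odd and small (`|a| ≤ 5`, `≤ 3`, `= 1` according
as `c (c - 1) = 12, 6, 2`) and then move (i) makes `|c|` strictly smaller, staying in `[-3, 4]`
("Thus, `-3 ≤ c ≤ 4`, so `0 ≤ c(c-1) ≤ 12`. Applying (ii), we can now arrange `-5 ≤ a ≤ 5` (since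
`a` is odd). By (i) again, we can now assume `|c| ≤ 2`, so `0 ≤ c(c-1) ≤ 6`. Continuing to
alternately apply (ii) and (i), we reduce to the case `c = 0` that we have already finished").
[cite: GompfAGT2010, Thm. 3.4 (proof, the descent)] -/
theorem exists_round (hΔ : gompf2010_deltaMove.{u}) (hA : IsGompfStandardForm A)
    (hdet : (A.1 - 1).det = 1) (he : A.1 2 1 = 0) (hc : A.1 1 1 ∈ Icc (-3 : ℤ) 4)
    (hc0 : A.1 1 1 ≠ 0) (hc1 : A.1 1 1 ≠ 1) :
    ∃ B : SL(3, ℤ), IsGompfStandardForm B ∧ (B.1 - 1).det = 1 ∧ B.1 2 1 = 0 ∧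
      B.1 1 1 ∈ Icc (-3 : ℤ) 4 ∧ (B.1 1 1).natAbs < (A.1 1 1).natAbs ∧
      (AllSpheresStandard.{u} B → AllSpheresStandard.{u} A) := by
  -- the windows: `a' ∈ [lo₁, lo₁ + c (c - 1) - 1]`, then `c' ∈ [lo₂, hi₂]` of length `≥ |a'|`
  obtain ⟨lo₁, lo₂, hi₂, hlen₁, hwin⟩ : ∃ lo₁ lo₂ hi₂ : ℤ,
      |A.1 1 1 * (A.1 1 1 - 1)| ≤ (lo₁ + A.1 1 1 * (A.1 1 1 - 1) - 1) - lo₁ + 1 ∧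
      ∀ a' : ℤ, Odd a' → a' ∈ Icc lo₁ (lo₁ + A.1 1 1 * (A.1 1 1 - 1) - 1) →
        a' ≠ 0 ∧ |a'| ≤ hi₂ - lo₂ + 1 ∧
          ∀ c' ∈ Icc lo₂ hi₂, c' ∈ Icc (-3 : ℤ) 4 ∧ c'.natAbs < (A.1 1 1).natAbs := by
    obtain ⟨hc₁, hc₂⟩ := hc
    generalize A.1 1 1 = c at *
    have key : ∀ a' : ℤ, Odd a' → a' % 2 = 1 := fun a' h => Int.odd_iff.1 h
    simp only [mem_Icc]
    interval_cases c
    · exact ⟨-5, -2, 2, by norm_num, fun a' ha' hI => have := key a' ha'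
        ⟨by omega, abs_le.2 ⟨by omega, by omega⟩, fun c' hc' => by omega⟩⟩
    · exact ⟨-2, -1, 1, by norm_num, fun a' ha' hI => have := key a' ha'
        ⟨by omega, abs_le.2 ⟨by omega, by omega⟩, fun c' hc' => by omega⟩⟩
    · exact ⟨-1, 0, 0, by norm_num, fun a' ha' hI => have := key a' ha'
        ⟨by omega, abs_le.2 ⟨by omega, by omega⟩, fun c' hc' => by omega⟩⟩
    · exact absurd rfl hc0
    · exact absurd rfl hc1
    · exact ⟨-1, 0, 0, by norm_num, fun a' ha' hI => have := key a' ha'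
        ⟨by omega, abs_le.2 ⟨by omega, by omega⟩, fun c' hc' => by omega⟩⟩
    · exact ⟨-2, -1, 1, by norm_num, fun a' ha' hI => have := key a' ha'
        ⟨by omega, abs_le.2 ⟨by omega, by omega⟩, fun c' hc' => by omega⟩⟩
    · exact ⟨-5, -2, 2, by norm_num, fun a' ha' hI => have := key a' ha'
        ⟨by omega, abs_le.2 ⟨by omega, by omega⟩, fun c' hc' => by omega⟩⟩
  have hn : A.1 1 1 * (A.1 1 1 - 1) ≠ 0 := mul_ne_zero hc0 (sub_ne_zero.2 hc1)
  -- move (ii): make `a` small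
  obtain ⟨k, hk⟩ := exists_add_mul_mem_Icc (A.1 0 1) lo₁ _ hn hlen₁
  obtain ⟨B₁, hsf₁, hdet₁, he₁, -, -, ha₁, himp₁⟩ := exists_moveTwo hΔ hA hdet he k
  rw [← ha₁] at hk
  have hodd : Odd (B₁.1 0 1) := by
    have := (odd_of_isGompfStandardForm hsf₁ hdet₁).1
    rwa [he₁, mul_zero, add_zero] at this
  obtain ⟨ha0, hlen₂, hdec⟩ := hwin _ hodd hk
  -- move (i): make `|c|` smaller
  obtain ⟨j, hj⟩ := exists_add_mul_mem_Icc (B₁.1 1 1) lo₂ hi₂ ha0 hlen₂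
  obtain ⟨B, hsf, hdetB, heB, -, hcB, hiff⟩ := exists_moveOne hsf₁ hdet₁ he₁ j
  rw [← hcB] at hj
  obtain ⟨hcI, hlt⟩ := hdec _ hj
  exact ⟨B, hsf, hdetB, heB, hcI, hlt, fun h => himp₁ (hiff.1 h)⟩

/-- **The descent of Thm. 3.4**: for `A` in standard form with `e = 0` and `c ∈ [-3, 4]`, the
spheres of `A` are standard (induction on `|c|`: rounds `exists_round`, base
`allSpheresStandard_of_c_eq_zero_or_one`). [cite: GompfAGT2010, Thm. 3.4 (proof, the descent)] -/
theorem allSpheresStandard_of_c_mem_Icc_of_natAbs_le (hΔ : gompf2010_deltaMove.{u})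
    (hAm : FamilyStandard.{u}) :
    ∀ (n : ℕ) (A : SL(3, ℤ)), IsGompfStandardForm A → (A.1 - 1).det = 1 → A.1 2 1 = 0 →
      A.1 1 1 ∈ Icc (-3 : ℤ) 4 → (A.1 1 1).natAbs ≤ n → AllSpheresStandard.{u} A
  | 0, A, hA, hdet, he, _, hn =>
    allSpheresStandard_of_c_eq_zero_or_one hAm hA hdet he (Or.inl (by omega))
  | n + 1, A, hA, hdet, he, hc, hn => by
    by_cases h01 : A.1 1 1 = 0 ∨ A.1 1 1 = 1
    · exact allSpheresStandard_of_c_eq_zero_or_one hAm hA hdet he h01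
    · obtain ⟨B, hsf, hdetB, heB, hcB, hlt, himp⟩ :=
        exists_round hΔ hA hdet he hc (fun h => h01 (Or.inl h)) (fun h => h01 (Or.inr h))
      exact himp (allSpheresStandard_of_c_mem_Icc_of_natAbs_le hΔ hAm n B hsf hdetB heB hcB
        (by omega))

/-- **Thm. 3.4 for `-3 ≤ c ≤ 4` (with `e = 0`)**, the conclusion of the descent. [cite: GompfAGT2010, Thm. 3.4 (proof, the descent)] -/
theorem allSpheresStandard_of_c_mem_Icc (hΔ : gompf2010_deltaMove.{u}) (hAm : FamilyStandard.{u})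
    (hA : IsGompfStandardForm A) (hdet : (A.1 - 1).det = 1) (he : A.1 2 1 = 0)
    (hc : A.1 1 1 ∈ Icc (-3 : ℤ) 4) : AllSpheresStandard.{u} A :=
  allSpheresStandard_of_c_mem_Icc_of_natAbs_le hΔ hAm _ A hA hdet he hc le_rfl

/-- **Thm. 3.4, second alternative, from the leaves**: for a Cappell–Shaneson matrix `A` in
standard form with `c ≡ r` mod `a + ce` for some `-3 ≤ r ≤ 4`, the spheres of `A` are standard —
conjugate to `e = 0` (`a ↦ a + ce`), apply move (i) to make `c = r`, and run the descent.
[cite: GompfAGT2010, Thm. 3.4 (proof)] -/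
theorem allSpheresStandard_of_modEq_sum (hΔ : gompf2010_deltaMove.{u}) (hAm : FamilyStandard.{u})
    (hA : IsGompfStandardForm A) (hdet : (A.1 - 1).det = 1) {r : ℤ} (hr : r ∈ Icc (-3 : ℤ) 4)
    (hmod : A.1 1 1 ≡ r [ZMOD A.1 0 1 + A.1 1 1 * A.1 2 1]) : AllSpheresStandard.{u} A := by
  -- conjugate to `e = 0`
  obtain ⟨hsf₁, ha₁, hc₁, -, he₁, -⟩ := entries_shear_conj hA (A.1 2 1)
  have hdet₁ : ((gompfShear (A.1 2 1) * A * (gompfShear (A.1 2 1))⁻¹).1 - 1).det = 1 := by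
    rw [det_coe_conj_sub_one]; exact hdet
  rw [sub_self] at he₁
  rw [← allSpheresStandard_conj_iff A (gompfShear (A.1 2 1))]
  -- move (i) with `r = c + k (a + ce)`
  obtain ⟨k, hk⟩ := Int.modEq_iff_dvd.1 hmod
  obtain ⟨B, hsf, hdetB, heB, -, hcB, hiff⟩ := exists_moveOne hsf₁ hdet₁ he₁ k
  rw [← hiff]
  refine allSpheresStandard_of_c_mem_Icc hΔ hAm hsf hdetB heB ?_
  rw [hcB, hc₁, ha₁,
    show A.1 1 1 + k * (A.1 0 1 + A.1 2 1 * A.1 1 1) = r by linear_combination -hk]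
  exact hr

/-- **Thm. 3.4, first alternative, from the leaves**: for a Cappell–Shaneson matrix `A` in
standard form with `c ≡ r` mod `d` for some `-3 ≤ r ≤ 4`, the spheres of `A` are standard — the
column move `A ↦ A Δᵏ` (derived from the row move, `gompf2010_deltaMoveRight_of_deltaMove`)
changes `c` by `kd` ("by arranging this beforehand (in the mod `d` case)"), then the second
alternative with `c = r`. [cite: GompfAGT2010, Thm. 3.4 (proof)] -/
theorem allSpheresStandard_of_modEq_d (hΔ : gompf2010_deltaMove.{u}) (hAm : FamilyStandard.{u})
    (hA : IsGompfStandardForm A) (hdet : (A.1 - 1).det = 1) {r : ℤ} (hr : r ∈ Icc (-3 : ℤ) 4)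
    (hmod : A.1 1 1 ≡ r [ZMOD A.1 1 2]) : AllSpheresStandard.{u} A := by
  obtain ⟨k, hk⟩ := Int.modEq_iff_dvd.1 hmod
  refine allSpheresStandard_of_deltaMoveRight hΔ hA hdet k ?_
  have hsf : IsGompfStandardForm (A * gompfDelta ^ k) := hA.mul_gompfDelta_zpow k
  have hdet' : ((A * gompfDelta ^ k).1 - 1).det = 1 := by
    rw [det_mul_gompfDelta_zpow_sub_one hA]; exact hdet
  obtain ⟨-, hc, -, -, -⟩ := entries_mul_gompfDelta_zpow k A
  rw [hA.2.1, mul_zero, sub_zero] at hc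
  have hc' : (A * gompfDelta ^ k).1 1 1 = r := by rw [hc]; linear_combination -hk
  refine allSpheresStandard_of_modEq_sum hΔ hAm hsf hdet' hr ?_
  rw [hc']

end Theorem34

/-! ### Theorem 3.2: the conjugacy classes of small trace -/

section Theorem32

/-- **"There is only one conjugacy class [of Cappell–Shaneson matrices] with trace `r`"** (the
hypothesis of Gompf 2010, Thm. 3.2): any two `B, B' ∈ SL(3, ℤ)` with
`det (B - 1) = det (B' - 1) = 1` and `tr B = tr B' = r` are conjugate in `SL(3, ℤ)` (equivalently
in `GL(3, ℤ)`, `isConj_iff_exists_isUnit_det`; Gompf: "This pair only depends on the conjugacy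
class of `A` in `GL(3, ℤ)`"). By Aitchison–Rubinstein's Appendix this says that the class number
of `f_r(x) = x³ - r x² + (r - 1) x - 1` is one. [cite: GompfAGT2010, Thm. 3.2] -/
def CSTraceClassUnique (r : ℤ) : Prop :=
  ∀ B B' : SL(3, ℤ), (B.1 - 1).det = 1 → (B'.1 - 1).det = 1 → B.1.trace = r → B'.1.trace = r →
    IsConj B B'

/-- `aitchisonRubinstein1984_uniqueTraceClass` in terms of `CSTraceClassUnique`. [cite: AitchisonRubinstein1984, Appendix (Conjugacy in SL(3,Z)), Table 1] -/
theorem csTraceClassUnique_of_mem_Icc (h : aitchisonRubinstein1984_uniqueTraceClass) {r : ℤ}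
    (hr : r ∈ Icc (-4 : ℤ) 9) : CSTraceClassUnique r :=
  fun B B' hB hB' htr htr' => h B B' hB hB' (htr ▸ hr) (htr'.trans htr.symm)

/-- **Aitchison–Rubinstein 1984, Appendix, Table 1, the row `(11, -6)` (named fact): a
Cappell–Shaneson matrix of trace `-6` or `11` is unique up to conjugacy.** Table 1 of loc. cit.
lists, for `a = 11` and `a = -6` (paired: `Δ(f_a) = Δ(f_{5-a}) = 4729`, prime), `R = R'` and
class number `1`; by Newman's theorem quoted there (Latimer–MacDuffee–Taussky) the conjugacy
classes of `A ∈ SL(3, ℤ)` with `det (A - I) = 1` and trace `a` (characteristic polynomial `f_a`)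
correspond to the ideal classes of `ℤ[θ_a]`, so there is a single class. As used by Gompf 2010,
Thm. 3.2: "`-6 ≤ r ≤ 9` or there is only one conjugacy class with trace `r` (e.g. `r = 11`)",
proof: "(see [AR] for `r = -6, 11`)". Companion of `aitchisonRubinstein1984_uniqueTraceClass`
(traces `[-4, 9]`, `CappellShanesonTraceClasses.lean`); the trace `-6` is what the last inequality
of Cor. 3.5 (`tr A ∉ [-6, 9]` for an exotic sphere) needs. Size: L (the class number of the cubic
field of discriminant `4729` and the LMT correspondence). [cite: AitchisonRubinstein1984, Appendix (Conjugacy in SL(3,Z)), Table 1] [cite: GompfAGT2010, Thm. 3.2 (statement and proof: r = -6, 11)] -/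
def aitchisonRubinstein1984_uniqueTraceClass_negSix_eleven : Prop :=
  ∀ (A B : SL(3, ℤ)), (A.1 - 1).det = 1 → (B.1 - 1).det = 1 →
    (A.1.trace = -6 ∨ A.1.trace = 11) → B.1.trace = A.1.trace → IsConj A B

/-- The trace `-6` / `11` fact in terms of `CSTraceClassUnique`. [cite: AitchisonRubinstein1984, Appendix (Conjugacy in SL(3,Z)), Table 1] -/
theorem csTraceClassUnique_of_negSix_eleven
    (h : aitchisonRubinstein1984_uniqueTraceClass_negSix_eleven) {r : ℤ} (hr : r = -6 ∨ r = 11) :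
    CSTraceClassUnique r :=
  fun B B' hB hB' htr htr' => h B B' hB hB' (htr ▸ hr) (htr'.trans htr.symm)

/-- Under `CSTraceClassUnique r`, a Cappell–Shaneson matrix of trace `r` has standard spheres:
it is conjugate to `A_{r-2}` ("so `A` is conjugate to `A_{r-2}`, and the result follows from
Example 3.1(a)"). [cite: GompfAGT2010, Thm. 3.2 (proof)] -/
theorem allSpheresStandard_of_csTraceClassUnique (hAm : FamilyStandard.{u}) {r : ℤ}
    (hU : CSTraceClassUnique r) {B : SL(3, ℤ)} (hdet : (B.1 - 1).det = 1) (htr : B.1.trace = r) :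
    AllSpheresStandard.{u} B := by
  have h := hU B (cappellShanesonMatrix (r - 2)) hdet (det_cappellShanesonMatrix_sub_one _) htr
    (by rw [trace_coe_cappellShanesonMatrix]; ring)
  rw [allSpheresStandard_congr_isConj h]
  exact allSpheresStandard_cappellShanesonMatrix hAm _

/-- **The spheres of Gompf's trace-`-5` matrix are standard** (Examples 3.1(b): "We can easily
change its trace to `1`, so the previous argument again shows that both associated homotopy
spheres are standard"): the row move `Δ²` and the explicit conjugation `gompfExample31b_conj` to
`A₋₁`. [cite: GompfAGT2010, Examples 3.1(b)] -/
theorem allSpheresStandard_gompfTraceNegFiveMatrix (hΔ : gompf2010_deltaMove.{u})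
    (hAm : FamilyStandard.{u}) : AllSpheresStandard.{u} gompfTraceNegFiveMatrix := by
  refine allSpheresStandard_of_deltaMove hΔ isGompfStandardForm_gompfTraceNegFiveMatrix
    det_gompfTraceNegFiveMatrix_sub_one 2 ?_
  rw [allSpheresStandard_congr_isConj isConj_gompfDelta_sq_mul_gompfTraceNegFiveMatrix]
  exact allSpheresStandard_cappellShanesonMatrix hAm (-1)

/-- **Cappell–Shaneson matrices of trace `-6 ≤ tr ≤ 9` have standard spheres** (the core of
Thm. 3.2: "For each of the listed values of `r` except `-5`, there is only one conjugacy class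
with trace `r` (see [AR] for `r = -6, 11`), so `A` is conjugate to `A_{r-2}`, and the result
follows from Example 3.1(a). The remaining case is settled by (b) above"), from the leaves.
[cite: GompfAGT2010, Thm. 3.2 (proof)] -/
theorem allSpheresStandard_of_trace_mem_Icc (hΔ : gompf2010_deltaMove.{u})
    (hAm : FamilyStandard.{u}) (hAR : aitchisonRubinstein1984_uniqueTraceClass)
    (hAR5 : aitchisonRubinstein1984_traceNegFiveClasses)
    (hAR6 : aitchisonRubinstein1984_uniqueTraceClass_negSix_eleven) {B : SL(3, ℤ)}
    (hdet : (B.1 - 1).det = 1) (htr : B.1.trace ∈ Icc (-6 : ℤ) 9) :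
    AllSpheresStandard.{u} B := by
  by_cases h5 : B.1.trace = -5
  · rcases hAR5.1 B hdet h5 with hc | hc
    · rw [← allSpheresStandard_congr_isConj hc]
      exact allSpheresStandard_cappellShanesonMatrix hAm (-7)
    · rw [← allSpheresStandard_congr_isConj hc]
      exact allSpheresStandard_gompfTraceNegFiveMatrix hΔ hAm
  by_cases h6 : B.1.trace = -6
  · exact allSpheresStandard_of_csTraceClassUnique hAm
      (csTraceClassUnique_of_negSix_eleven hAR6 (Or.inl rfl)) hdet h6
  · have hr : B.1.trace ∈ Icc (-4 : ℤ) 9 := by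
      obtain ⟨h1, h2⟩ := htr
      exact ⟨by omega, h2⟩
    exact allSpheresStandard_of_csTraceClassUnique hAm (csTraceClassUnique_of_mem_Icc hAR hr)
      hdet rfl

end Theorem32

/-! ### The named fact Thm. 3.2, and the assembly of Cor. 3.5 from Thms. 3.2 and 3.4 -/

section Corollary35

/-- **Gompf 2010, Theorem 3.2, first sentence (named fact).** "Suppose the Cappell-Shaneson
matrix `A` can be conjugated to standard form with `tr(A) ≡ r` mod `d` for some `r ∈ ℤ` such that
`-6 ≤ r ≤ 9` or there is only one conjugacy class with trace `r` (e.g. `r = 11`). Then both homotopy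
spheres associated to `A` are diffeomorphic to `S⁴`." Rendering: `A ∈ SL(3, ℤ)` with
`det (A - 1) = 1` (Gompf's normalisation of "Cappell-Shaneson matrix"), a conjugate `P A P⁻¹`
(`P ∈ SL(3, ℤ)`, which loses nothing against `GL(3, ℤ)`) in standard form
`!![0, a, b; 0, c, d; 1, e, f]` whose trace is `≡ r [ZMOD d]`, `d = (P A P⁻¹)₁₂`, and
`r ∈ [-6, 9] ∨ CSTraceClassUnique r`; conclusion `AllSpheresStandard A` (every Cappell–Shaneson
sphere of `A`, either framing, is `≅ S⁴`). The last sentence of Thm. 3.2 ("In particular, this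
holds whenever `|d| < 17`") is the sibling file's `gompf2010_theorem32_d`
(`gompf2010_theorem32_d_of_theorem32` below; Part I proves it from the leaves directly). PROVED
below from the leaves (`gompf2010_theorem32_of_leaves`). [cite: GompfAGT2010, Thm. 3.2] -/
def gompf2010_theorem32 : Prop :=
  ∀ (A P : SL(3, ℤ)) (r : ℤ), (A.1 - 1).det = 1 → IsGompfStandardForm (P * A * P⁻¹) →
    (P * A * P⁻¹).1.trace ≡ r [ZMOD (P * A * P⁻¹).1 1 2] →
    (r ∈ Icc (-6 : ℤ) 9 ∨ CSTraceClassUnique r) → AllSpheresStandard.{u} A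

/-! **Gompf 2010, Theorem 3.4 — the statement.** "Suppose the Cappell-Shaneson matrix `A` can
be conjugated to standard form with `c ≡ r` mod `d` or mod `a + ce` where `-3 ≤ r ≤ 4`. Then both
homotopy spheres associated to `A` are diffeomorphic to `S⁴`." Rendered as for
`gompf2010_theorem32`: `A ∈ SL(3, ℤ)` with `det (A - 1) = 1`, a conjugate `P A P⁻¹`
(`P ∈ SL(3, ℤ)`) in standard form with entries `a = (P A P⁻¹)₀₁`, `c = (P A P⁻¹)₁₁`,
`d = (P A P⁻¹)₁₂`, `e = (P A P⁻¹)₂₁`, `r ∈ [-3, 4]`, `c ≡ r [ZMOD d] ∨ c ≡ r [ZMOD a + ce]`;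
conclusion `AllSpheresStandard A`. This statement is NOT a named fact of the tree (it was one,
`gompf2010_theorem34`, merged back on review, 2026-08-15, D-0026/D-0027: its discharge would be
exactly the discharge of the leaves below, which are named facts with their own units); it is
spelled out verbatim as the conclusion of `gompf2010_theorem34_of_leaves` (the row move —
which yields the column move, `gompf2010_deltaMoveRight_of_deltaMove` —, Thm 4.3, [AK1];
`gompf2010_theorem34_of_leaves'` is the same theorem under its historical name), and in Part IV of
`gompf2010_theorem34_of_deltaMove_of_familyStandard` (the sharp printed dependency: the Δ-move and
Examples 3.1(a)) and `gompf2010_theorem34_of_framedTwist_AK` (the two live geometric leaves). -/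

/-- **Thm. 3.2 from the leaves**: the Δ-move (Thm 2.1/§3), Thm 4.3, [AK1], and the
Aitchison–Rubinstein class numbers for traces `[-4, 9]`, `-5`, `-6`. Proof as printed: conjugate to
standard form; "we can assume `tr(A) = r`" by the row move `Δᵏ` (`tr ↦ tr + kd`,
`IsGompfStandardForm.trace_gompfDelta_zpow_mul`); then `allSpheresStandard_of_trace_mem_Icc`, or,
under `CSTraceClassUnique r`, conjugate to `A_{r-2}`. [cite: GompfAGT2010, Thm. 3.2 (proof)] -/
theorem gompf2010_theorem32_of_leaves (hΔ : gompf2010_deltaMove.{u})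
    (h43 : gompf2010_akbulutKirby_framings.{0, 0}) (hAK : akbulutKirby1979_sphere_four)
    (hAR : aitchisonRubinstein1984_uniqueTraceClass)
    (hAR5 : aitchisonRubinstein1984_traceNegFiveClasses)
    (hAR6 : aitchisonRubinstein1984_uniqueTraceClass_negSix_eleven) : gompf2010_theorem32.{u} := by
  have hAm : FamilyStandard.{u} := familyStandard_of_leaves hΔ h43 hAK
  intro A P r hdet hsf hmod hr
  rw [← allSpheresStandard_conj_iff A P]
  have hdetB : ((P * A * P⁻¹).1 - 1).det = 1 := by rw [det_coe_conj_sub_one]; exact hdet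
  -- the row move to trace `r`
  obtain ⟨k, hk⟩ := Int.modEq_iff_dvd.1 hmod
  refine allSpheresStandard_of_deltaMove hΔ hsf hdetB k ?_
  have hdet' : ((gompfDelta ^ k * (P * A * P⁻¹)).1 - 1).det = 1 := by
    rw [hsf.det_gompfDelta_zpow_mul_sub_one]; exact hdetB
  have htr : (gompfDelta ^ k * (P * A * P⁻¹)).1.trace = r := by
    rw [hsf.trace_gompfDelta_zpow_mul]; linear_combination -hk
  rcases hr with hr | hr
  · exact allSpheresStandard_of_trace_mem_Icc hΔ hAm hAR hAR5 hAR6 hdet' (htr ▸ hr)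
  · exact allSpheresStandard_of_csTraceClassUnique hAm hr hdet' htr

/-- **Thm. 3.4 from the three leaves of Examples 3.1(a)** — the row move `gompf2010_deltaMove`
(which yields the column move, `gompf2010_deltaMoveRight_of_deltaMove`), Thm 4.3 and [AK1]; no
number theory, as printed ("Theorem 3.4 can be proved without appealing to algebraic number
theory"). When the leaves are discharged, this theorem applied to their proofs is Thm. 3.4
outright. [cite: GompfAGT2010, Thm. 3.4 (proof)] -/
theorem gompf2010_theorem34_of_leaves (hΔ : gompf2010_deltaMove.{u})
    (h43 : gompf2010_akbulutKirby_framings.{0, 0}) (hAK : akbulutKirby1979_sphere_four) :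
    ∀ (A P : SL(3, ℤ)) (r : ℤ), (A.1 - 1).det = 1 → IsGompfStandardForm (P * A * P⁻¹) →
      r ∈ Icc (-3 : ℤ) 4 →
      ((P * A * P⁻¹).1 1 1 ≡ r [ZMOD (P * A * P⁻¹).1 1 2] ∨
        (P * A * P⁻¹).1 1 1 ≡ r [ZMOD (P * A * P⁻¹).1 0 1 +
          (P * A * P⁻¹).1 1 1 * (P * A * P⁻¹).1 2 1]) →
      AllSpheresStandard.{u} A := by
  have hAm : FamilyStandard.{u} := familyStandard_of_leaves hΔ h43 hAK
  intro A P r hdet hsf hr hmod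
  rw [← allSpheresStandard_conj_iff A P]
  have hdetB : ((P * A * P⁻¹).1 - 1).det = 1 := by rw [det_coe_conj_sub_one]; exact hdet
  rcases hmod with hmod | hmod
  · exact allSpheresStandard_of_modEq_d hΔ hAm hsf hdetB hr hmod
  · exact allSpheresStandard_of_modEq_sum hΔ hAm hsf hdetB hr hmod

/-- **Thm. 3.4 from the three leaves of Examples 3.1(a)** (the same theorem as
`gompf2010_theorem34_of_leaves`, kept under its historical name: before the column move was merged
into `gompf2010_deltaMoveRight_of_deltaMove`, the unprimed theorem took the column move as an
extra hypothesis and this one derived it). [cite: GompfAGT2010, Thm. 3.4 (proof)] -/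
theorem gompf2010_theorem34_of_leaves' (hΔ : gompf2010_deltaMove.{u})
    (h43 : gompf2010_akbulutKirby_framings.{0, 0}) (hAK : akbulutKirby1979_sphere_four) :
    ∀ (A P : SL(3, ℤ)) (r : ℤ), (A.1 - 1).det = 1 → IsGompfStandardForm (P * A * P⁻¹) →
      r ∈ Icc (-3 : ℤ) 4 →
      ((P * A * P⁻¹).1 1 1 ≡ r [ZMOD (P * A * P⁻¹).1 1 2] ∨
        (P * A * P⁻¹).1 1 1 ≡ r [ZMOD (P * A * P⁻¹).1 0 1 +
          (P * A * P⁻¹).1 1 1 * (P * A * P⁻¹).1 2 1]) →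
      AllSpheresStandard.{u} A :=
  gompf2010_theorem34_of_leaves hΔ h43 hAK

/-- **Thm. 3.2, last sentence, from the first** ("The last sentence follows once we rule out the
case `d = 0` by the following lemma"): `d` is odd (Lemma 3.3,
`IsGompfStandardForm.apply_one_two_ne_zero`), so some `tr A + kd` lies in Gompf's window `[-6, 9]`
of `16 ≥ |d|` consecutive integers. Yields the sibling file's named fact `gompf2010_theorem32_d`.
[cite: GompfAGT2010, Thm. 3.2 (proof) and Lemma 3.3] -/
theorem gompf2010_theorem32_d_of_theorem32 (h32 : gompf2010_theorem32.{u}) :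
    gompf2010_theorem32_d.{u} := by
  intro A hA hdet hd X _ _ _ _ _ _ hX
  obtain ⟨k, hk⟩ := exists_add_mul_mem_Icc A.1.trace (-6) 9 (hA.apply_one_two_ne_zero hdet)
    (by have := abs_lt.1 hd; exact abs_le.2 ⟨by omega, by omega⟩)
  refine h32 A 1 (A.1.trace + k * A.1 1 2) hdet (by simpa using hA) ?_ (Or.inl hk) X hX
  simp only [mul_one, inv_one, one_mul]
  exact Int.modEq_iff_dvd.2 ⟨k, by ring⟩

/-- **Cor. 3.5 from Thm. 3.2 and the `a + ce` alternative of Thm. 3.4** (the printed proof is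
"□": contrapose each inequality). `|d| ≥ 17`: Thm. 3.2, last sentence. `|a + ce| ≥ 9`: `a + ce` is
odd (hence `≠ 0`), so if `|a + ce| ≤ 8` some `c + k (a + ce)` lies in the window `[-3, 4]` of `8`
integers, i.e. `c ≡ r` mod `a + ce` with `-3 ≤ r ≤ 4`. `|c - ½| > 4`: otherwise `-3 ≤ c ≤ 4` and
`r = c` works. `|c + f - 3/2| > 8`: otherwise `-6 ≤ tr A = c + f ≤ 9` and `r = tr A` works in
Thm. 3.2. The conclusion is the statement of Cor. 3.5 (formerly the body of the sibling file's
named fact `gompf2010_corollary35`, merged back by its D-0026/D-0027 review, 2026-08-15): for `A`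
in standard form with `det (A - 1) = 1` (entries `a = A₀₁`, `c = A₁₁`, `d = A₁₂`, `e = A₂₁`,
`f = A₂₂`) having a Cappell–Shaneson sphere `X ≇ S⁴`, `17 ≤ |d|`, `9 ≤ |a + ce|`, `8 < |2c - 1|`
and `16 < |2(c + f) - 3|`. [cite: GompfAGT2010, Cor. 3.5] -/
theorem gompf2010_corollary35_of_theorem32_of_modEq_sum (h32 : gompf2010_theorem32.{u})
    (h34 : ∀ (A : SL(3, ℤ)) (r : ℤ), (A.1 - 1).det = 1 → IsGompfStandardForm A → r ∈ Icc (-3 : ℤ) 4 →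
      A.1 1 1 ≡ r [ZMOD A.1 0 1 + A.1 1 1 * A.1 2 1] → AllSpheresStandard.{u} A) :
    ∀ (A : SL(3, ℤ)), IsGompfStandardForm A → (A.1 - 1).det = 1 →
      ∀ (X : Type u) [TopologicalSpace X] [T2Space X] [SecondCountableTopology X]
        [ChartedSpace (EuclideanSpace ℝ (Fin 4)) X] [IsManifold (𝓡 4) ∞ X] [CompactSpace X],
        IsCappellShanesonSphereOf A X →
        IsEmpty (X ≃ₘ⟮𝓡 4, 𝓡 4⟯ (Metric.sphere (0 : EuclideanSpace ℝ (Fin (4 + 1))) 1)) →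
          17 ≤ |A.1 1 2| ∧ 9 ≤ |A.1 0 1 + A.1 1 1 * A.1 2 1| ∧ 8 < |2 * A.1 1 1 - 1| ∧
            16 < |2 * (A.1 1 1 + A.1 2 2) - 3| := by
  intro A hA hdet X _ _ _ _ _ _ hX hE
  have hne : ¬ AllSpheresStandard.{u} A := fun h => (h X hX).elim fun e => hE.false e
  have htr := trace_of_isGompfStandardForm hA
  refine ⟨?_, ?_, ?_, ?_⟩ <;> by_contra hcon <;> refine hne ?_
  · -- `|d| < 17`
    exact fun Y _ _ _ _ _ _ hY => gompf2010_theorem32_d_of_theorem32 h32 A hA hdet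
      (not_le.1 hcon) Y hY
  · -- `|a + ce| ≤ 8`
    have hodd := (odd_of_isGompfStandardForm hA hdet).1
    have h0 : A.1 0 1 + A.1 1 1 * A.1 2 1 ≠ 0 := fun h0 => by
      rw [h0] at hodd; exact (Int.not_odd_iff_even.2 (by decide)) hodd
    obtain ⟨k, hk⟩ := exists_add_mul_mem_Icc (A.1 1 1) (-3) 4 h0
      (by have := not_le.1 hcon; have := abs_lt.1 this; exact abs_le.2 ⟨by omega, by omega⟩)
    exact h34 A _ hdet hA hk (Int.modEq_iff_dvd.2 ⟨k, by ring⟩)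
  · -- `-3 ≤ c ≤ 4`
    refine h34 A (A.1 1 1) hdet hA ?_ (Int.ModEq.refl _)
    have := not_lt.1 hcon
    rw [abs_le] at this
    constructor <;> omega
  · -- `-6 ≤ c + f ≤ 9`
    refine h32 A 1 A.1.trace hdet (by simpa using hA) (by simp [Int.ModEq.refl]) (Or.inl ?_)
    have := not_lt.1 hcon
    rw [abs_le] at this
    rw [htr]
    constructor <;> omega

/-- **Cor. 3.5 from Thms. 3.2 and 3.4** (the printed dependency: the named fact
`gompf2010_theorem32` and the statement of Thm. 3.4, of which only the `a + ce` alternative with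
`P = 1` is used); the conclusion is the statement of Cor. 3.5. [cite: GompfAGT2010, Cor. 3.5] -/
theorem gompf2010_corollary35_of_theorems (h32 : gompf2010_theorem32.{u})
    (h34 : ∀ (A P : SL(3, ℤ)) (r : ℤ), (A.1 - 1).det = 1 → IsGompfStandardForm (P * A * P⁻¹) →
      r ∈ Icc (-3 : ℤ) 4 →
      ((P * A * P⁻¹).1 1 1 ≡ r [ZMOD (P * A * P⁻¹).1 1 2] ∨
        (P * A * P⁻¹).1 1 1 ≡ r [ZMOD (P * A * P⁻¹).1 0 1 +
          (P * A * P⁻¹).1 1 1 * (P * A * P⁻¹).1 2 1]) →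
      AllSpheresStandard.{u} A) :
    ∀ (A : SL(3, ℤ)), IsGompfStandardForm A → (A.1 - 1).det = 1 →
      ∀ (X : Type u) [TopologicalSpace X] [T2Space X] [SecondCountableTopology X]
        [ChartedSpace (EuclideanSpace ℝ (Fin 4)) X] [IsManifold (𝓡 4) ∞ X] [CompactSpace X],
        IsCappellShanesonSphereOf A X →
        IsEmpty (X ≃ₘ⟮𝓡 4, 𝓡 4⟯ (Metric.sphere (0 : EuclideanSpace ℝ (Fin (4 + 1))) 1)) →
          17 ≤ |A.1 1 2| ∧ 9 ≤ |A.1 0 1 + A.1 1 1 * A.1 2 1| ∧ 8 < |2 * A.1 1 1 - 1| ∧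
            16 < |2 * (A.1 1 1 + A.1 2 2) - 3| :=
  gompf2010_corollary35_of_theorem32_of_modEq_sum h32 fun A r hdet hA hr hmod =>
    h34 A 1 r hdet (by simpa using hA) hr (Or.inr (by simpa using hmod))

/-- **Cor. 3.5 from the leaves.** Cor. 3.5 (the statement displayed as the conclusion) follows
from: the row Δ-move
`gompf2010_deltaMove` (Gompf Thm 2.1/§3), Thm 4.3 `gompf2010_akbulutKirby_framings`,
Akbulut–Kirby 1979 `akbulutKirby1979_sphere_four`, and the Aitchison–Rubinstein conjugacy-class
facts `aitchisonRubinstein1984_uniqueTraceClass` (traces `[-4, 9]`),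
`aitchisonRubinstein1984_traceNegFiveClasses` (trace `-5`) and
`aitchisonRubinstein1984_uniqueTraceClass_negSix_eleven` (trace `-6`); everything else (Lemma 3.3,
the matrix algebra of §3, the descent of Thm. 3.4, Examples 3.1(b), the assembly) is proved in the
tree. The column move is not needed. When the leaves are discharged, Cor. 3.5 outright is this
theorem applied to their proofs (with the current leaf set: `gompf2010_corollary35_of_framedTwist_AK`,
`CappellShanesonFamilyStandardHolds.lean`). [cite: GompfAGT2010, Cor. 3.5] -/
theorem gompf2010_corollary35_of_leaves (hΔ : gompf2010_deltaMove.{u})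
    (h43 : gompf2010_akbulutKirby_framings.{0, 0}) (hAK : akbulutKirby1979_sphere_four)
    (hAR : aitchisonRubinstein1984_uniqueTraceClass)
    (hAR5 : aitchisonRubinstein1984_traceNegFiveClasses)
    (hAR6 : aitchisonRubinstein1984_uniqueTraceClass_negSix_eleven) :
    ∀ (A : SL(3, ℤ)), IsGompfStandardForm A → (A.1 - 1).det = 1 →
      ∀ (X : Type u) [TopologicalSpace X] [T2Space X] [SecondCountableTopology X]
        [ChartedSpace (EuclideanSpace ℝ (Fin 4)) X] [IsManifold (𝓡 4) ∞ X] [CompactSpace X],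
        IsCappellShanesonSphereOf A X →
        IsEmpty (X ≃ₘ⟮𝓡 4, 𝓡 4⟯ (Metric.sphere (0 : EuclideanSpace ℝ (Fin (4 + 1))) 1)) →
          17 ≤ |A.1 1 2| ∧ 9 ≤ |A.1 0 1 + A.1 1 1 * A.1 2 1| ∧ 8 < |2 * A.1 1 1 - 1| ∧
            16 < |2 * (A.1 1 1 + A.1 2 2) - 3| :=
  gompf2010_corollary35_of_theorem32_of_modEq_sum
    (gompf2010_theorem32_of_leaves hΔ h43 hAK hAR hAR5 hAR6) fun _ _ hdet hA hr hmod =>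
    allSpheresStandard_of_modEq_sum hΔ (familyStandard_of_leaves hΔ h43 hAK) hA hdet hr hmod


end Corollary35

end Literature.Barriers.SmoothPoincare4

/-! ## Part III — `CappellShanesonFamilyBarrier`: the barrier for the family `Aₘ` -/

namespace Literature.Barriers.SmoothPoincare4

universe u

open scoped MatrixGroups

section FamilyBarrier

/-! ### The barrier is the parent fact, closed over `X : Type` -/

/-- **The family barrier is exactly `FamilyStandard.{0}`.** `CappellShanesonFamilyBarrier` (no
Cappell–Shaneson sphere of any `Aₘ`, either framing, is exotic) is *equivalent* to the tree's
named fact `nonempty_diffeomorph_sphere_four_of_isCappellShanesonSphereOf X` closed over all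
closed smooth `X : Type` (Gompf 2010, Examples 3.1(a); Akbulut 2010, Thm. 1: "`Σₘ` is
diffeomorphic to `S⁴`, for each `m ∈ ℤ`"): the technique class
`ExoticCappellShanesonSphere (range cappellShanesonMatrix)` quantifies over exactly these `X`. So
the discharge `CappellShanesonFamilyBarrier_holds` is `FamilyStandard.{0}` and nothing less.
[cite: GompfAGT2010, Examples 3.1(a)] [cite: Akbulut2010, Thm. 1] -/
theorem cappellShanesonFamilyBarrier_iff_familyStandard :
    CappellShanesonFamilyBarrier ↔ FamilyStandard.{0} := by
  refine ⟨fun h X _ _ _ _ _ _ m hX => ?_,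
    fun h => cappellShanesonFamilyBarrier_of_akbulut_gompf fun X _ _ _ _ _ _ => h X⟩
  by_contra hno
  exact h ⟨cappellShanesonMatrix m, ⟨m, rfl⟩, X, ‹_›, ‹_›, ‹_›, ‹_›, ‹_›, ‹_›, hX,
    ⟨fun e => hno ⟨e⟩⟩⟩

/-- The barrier matrix by matrix: "both homotopy spheres associated to `Aₘ` are diffeomorphic to
`S⁴`" for every `m` (`AllSpheresStandard.{0} (cappellShanesonMatrix m)`). [cite: GompfAGT2010, Examples 3.1(a)] -/
theorem cappellShanesonFamilyBarrier_iff_allSpheresStandard :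
    CappellShanesonFamilyBarrier ↔ ∀ m : ℤ, AllSpheresStandard.{0} (cappellShanesonMatrix m) := by
  rw [cappellShanesonFamilyBarrier_iff_familyStandard]
  exact ⟨fun h m => allSpheresStandard_cappellShanesonMatrix h m,
    fun h X _ _ _ _ _ _ m hX => h m X hX⟩

/-! ### Standardness is decided on Gompf's concrete spheres `X^σ_A` -/

/-- **From the concrete spheres to all spheres.** If each of Gompf's concrete spheres
`X^σ_A = gompfSphere A γ = (sectionCircleNbhd A γ).Surgered` (`γ` a smooth path from `1` to `A`
framing the tube of the section circle) is `S⁴`, then *every* Cappell–Shaneson sphere of `A` —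
any mapping torus of `torusDiffeomorph A`, any parametrisation of the section circle, any tube,
any realisation of the surgery gluing, in any universe — is `S⁴`: by the classification of
Cappell–Shaneson spheres by straightenings PROVED in the tree
(`gompf2010_straightening_classification_holds`; Gompf 2010, §4 ¶2: "the two straightenings `σ` …
canonically determine … the two resulting diffeomorphism types, which we denote by `X^σ`", with
the uniqueness of tubular neighbourhoods, Kosinski III.3, and of surgery on a framed circle,
Gompf–Stipsicz §5.2). [cite: GompfAGT2010, §4 ¶2 (X^σ well defined; framings ↔ straightenings)] -/
theorem allSpheresStandard_of_gompfSphere (A : SL(3, ℤ))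
    (h : ∀ γ : SmoothMatrixPath (slRealMatrix A), Nonempty (gompfSphere A γ ≃ₘ⟮𝓡 4, 𝓡 4⟯
      (Metric.sphere (0 : EuclideanSpace ℝ (Fin (4 + 1))) 1))) :
    AllSpheresStandard.{u} A := by
  intro X _ _ _ _ _ _ hX
  obtain ⟨γ, ⟨e⟩⟩ := gompf2010_straightening_classification_holds A X hX
  obtain ⟨f⟩ := h γ
  exact ⟨e.trans f⟩

/-- **`AllSpheresStandard A` is decided on the concrete `X^σ_A`** (at `Type`, for
`det (A - 1) = ±1`): the concrete spheres are Cappell–Shaneson spheres of `A`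
(`isCappellShanesonSphereOf_gompfSphere`), and conversely every sphere of `A` is one of them up to
diffeomorphism (`allSpheresStandard_of_gompfSphere`). [cite: GompfAGT2010, §4 (the manifolds X^σ, after Def. 4.1) and §4 ¶2] -/
theorem allSpheresStandard_iff_gompfSphere (A : SL(3, ℤ))
    (hA : (A.1 - 1).det = 1 ∨ (A.1 - 1).det = -1) :
    AllSpheresStandard.{0} A ↔ ∀ γ : SmoothMatrixPath (slRealMatrix A),
      Nonempty (gompfSphere A γ ≃ₘ⟮𝓡 4, 𝓡 4⟯
        (Metric.sphere (0 : EuclideanSpace ℝ (Fin (4 + 1))) 1)) :=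
  ⟨fun h γ => h (gompfSphere A γ) (isCappellShanesonSphereOf_gompfSphere A γ hA),
    allSpheresStandard_of_gompfSphere A⟩

/-- **The family barrier in concrete terms.** `CappellShanesonFamilyBarrier` holds iff each of
Gompf's concrete spheres `X^σ_{Aₘ} = gompfSphere (cappellShanesonMatrix m) γ` (`m ∈ ℤ`; `γ` any
smooth path from `1` to `Aₘ` framing the tube, both straightening classes — i.e. both framings —
occurring) is diffeomorphic to `S⁴`. [cite: GompfAGT2010, Examples 3.1(a) and §4 ¶2] -/
theorem cappellShanesonFamilyBarrier_iff_gompfSphere :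
    CappellShanesonFamilyBarrier ↔
      ∀ (m : ℤ) (γ : SmoothMatrixPath (slRealMatrix (cappellShanesonMatrix m))),
        Nonempty (gompfSphere (cappellShanesonMatrix m) γ ≃ₘ⟮𝓡 4, 𝓡 4⟯
          (Metric.sphere (0 : EuclideanSpace ℝ (Fin (4 + 1))) 1)) := by
  rw [cappellShanesonFamilyBarrier_iff_allSpheresStandard]
  exact forall_congr' fun m =>
    allSpheresStandard_iff_gompfSphere _ (Or.inl (det_cappellShanesonMatrix_sub_one m))

/-- **The technique class is realised by honest manifolds.** An exotic Cappell–Shaneson sphere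
from the family `Aₘ` exists iff one of the concrete closed smooth 4-manifolds
`gompfSphere (cappellShanesonMatrix m) γ` — glued mapping torus of `Aₘ` on `T³`, surgered along the
section circle with the tube framed by `γ` — is not diffeomorphic to `S⁴`; such `γ` exist for
every `m` (`nonempty_smoothMatrixPath_specialLinearGroup`), so the class the barrier rules out is a
family of actual manifolds, two framings for each `m`. [cite: GompfAGT2010, §1 and §4 (the manifolds X^σ)] [cite: CappellShaneson1976, §2] -/
theorem exoticCappellShanesonSphere_range_iff_gompfSphere :
    ExoticCappellShanesonSphere (range cappellShanesonMatrix) ↔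
      ∃ (m : ℤ) (γ : SmoothMatrixPath (slRealMatrix (cappellShanesonMatrix m))),
        IsEmpty (gompfSphere (cappellShanesonMatrix m) γ ≃ₘ⟮𝓡 4, 𝓡 4⟯
          (Metric.sphere (0 : EuclideanSpace ℝ (Fin (4 + 1))) 1)) := by
  have h := cappellShanesonFamilyBarrier_iff_gompfSphere.not
  simp only [CappellShanesonFamilyBarrier, not_not, not_forall, not_nonempty_iff] at h
  exact h

/-! ### What the barrier contains: [AK1] and Theorem 4.3 at `Type` -/

/-- The barrier gives back the standardness of every sphere of the Akbulut–Kirby matrix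
`A₀ = cappellShanesonMatrix 0`. [cite: GompfAGT2010, Examples 3.1(a)] -/
theorem CappellShanesonFamilyBarrier.allSpheresStandard_akbulutKirby
    (h : CappellShanesonFamilyBarrier) : AllSpheresStandard.{0} akbulutKirbyMatrix := by
  rw [← cappellShanesonMatrix_zero]
  exact cappellShanesonFamilyBarrier_iff_allSpheresStandard.1 h 0

/-- **The barrier contains [AK1]** (framed form `akbulutKirby1979_linearStraightening`: Gompf's
`X^{σ_lin}_{A₀}` is `S⁴`; Akbulut–Kirby 1979). So any discharge of the barrier proves [AK1] on
the tree's concrete manifold. [cite: AkbulutKirby1979, main theorem (Σ ≅ S⁴)] [cite: GompfAGT2010, §1 (on AK1)] -/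
theorem CappellShanesonFamilyBarrier.akbulutKirby1979_linearStraightening
    (h : CappellShanesonFamilyBarrier) : akbulutKirby1979_linearStraightening :=
  (allSpheresStandard_iff_gompfSphere _ (Or.inl det_akbulutKirbyMatrix_sub_one)).1
    h.allSpheresStandard_akbulutKirby akbulutKirbyLinearPath

/-- The barrier contains the framing-free [AK1] leaf `akbulutKirby1979_sphere_four` of
`CappellShanesonGompfReduction.lean`. [cite: AkbulutKirby1979, main theorem (Σ ≅ S⁴)] -/
theorem CappellShanesonFamilyBarrier.akbulutKirby1979_sphere_four
    (h : CappellShanesonFamilyBarrier) : akbulutKirby1979_sphere_four :=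
  akbulutKirby1979_sphere_four_of_framed h.akbulutKirby1979_linearStraightening

/-- **The barrier contains Theorem 4.3** (framed form `gompf2010_thm43`: all concrete
`A₀`-spheres `gompfSphere A₀ γ` are diffeomorphic to each other — here because each is `S⁴`).
[cite: GompfAGT2010, Thm 4.3] -/
theorem CappellShanesonFamilyBarrier.gompf2010_thm43 (h : CappellShanesonFamilyBarrier) :
    gompf2010_thm43 := by
  intro γ γ'
  have hA := (allSpheresStandard_iff_gompfSphere _ (Or.inl det_akbulutKirbyMatrix_sub_one)).1
    h.allSpheresStandard_akbulutKirby
  obtain ⟨e⟩ := hA γ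
  obtain ⟨e'⟩ := hA γ'
  exact ⟨e.trans e'.symm⟩

/-- The barrier contains the framing-free Theorem 4.3 leaf `gompf2010_akbulutKirby_framings` of
`CappellShanesonGompfReduction.lean` at `Type`. [cite: GompfAGT2010, Thm 4.3] -/
theorem CappellShanesonFamilyBarrier.gompf2010_akbulutKirby_framings
    (h : CappellShanesonFamilyBarrier) : gompf2010_akbulutKirby_framings.{0, 0} := by
  intro X _ _ _ _ _ _ X' _ _ _ _ _ _ hX hX'
  obtain ⟨e⟩ := h.allSpheresStandard_akbulutKirby X hX
  obtain ⟨e'⟩ := h.allSpheresStandard_akbulutKirby X' hX'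
  exact ⟨e.trans e'.symm⟩

/-! ### Examples 3.1(a): the reduction to `A₀`, and the barrier from each leaf set -/

/-- Both spheres of `A₀` are standard, from Theorem 4.3 and [AK1] in the framing-free forms of
`CappellShanesonGompfReduction.lean` ("both homotopy spheres arising from `A₀` are standard (by
[AK1] for the untwisted framing and Theorem 4.3 …)"). [cite: GompfAGT2010, Examples 3.1(a)] -/
theorem allSpheresStandard_akbulutKirby_of (h43 : gompf2010_akbulutKirby_framings.{u, 0})
    (hAK : akbulutKirby1979_sphere_four) : AllSpheresStandard.{u} akbulutKirbyMatrix :=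
  fun X _ _ _ _ _ _ hX =>
    nonempty_diffeomorph_sphere_four_of_isCappellShanesonSphereOf_akbulutKirby_of X h43 hAK hX

/-- **Gompf 2010, Examples 3.1(a), as a reduction of the barrier to `A₀`.** Granted the Δ-move
(`gompf2010_deltaMove`, Thm 2.1/§3) and that both spheres of `A₀` are standard, no sphere of any
`Aₘ` is exotic: "Since `Aₘ` is in standard form with `d = 1`, we can change it to have any
trace, say `2`. The resulting matrix [`Δ^{-m} Aₘ`] must be conjugate to `A₀` … (In fact, this is
easy to see directly, by adding `m` times the first column to the second while subtracting `m`
times the second row from the first.) [`E_m⁻¹ (Δ^{-m} Aₘ) E_m = A₀`,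
`gompfShear_inv_mul_mul_gompfShear`] Since both homotopy spheres arising from `A₀` are standard …
the result follows." [cite: GompfAGT2010, Examples 3.1(a)] -/
theorem cappellShanesonFamilyBarrier_of_deltaMove_of_akbulutKirby (hΔ : gompf2010_deltaMove.{0})
    (h₀ : AllSpheresStandard.{0} akbulutKirbyMatrix) : CappellShanesonFamilyBarrier := by
  rw [cappellShanesonFamilyBarrier_iff_allSpheresStandard]
  intro m
  refine allSpheresStandard_of_deltaMove hΔ (isGompfStandardForm_cappellShanesonMatrix m)
    (det_cappellShanesonMatrix_sub_one m) (-m) ?_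
  have h : gompfDelta ^ (-m) * cappellShanesonMatrix m =
      gompfShear m * akbulutKirbyMatrix * (gompfShear m)⁻¹ := by
    rw [← gompfShear_inv_mul_mul_gompfShear m]; group
  rw [h, allSpheresStandard_conj_iff]
  exact h₀

/-- **The barrier from the leaves of `CappellShanesonGompfReduction.lean`**: the Δ-move
(Thm 2.1/§3), Theorem 4.3 and [AK1] in their framing-free forms. [cite: GompfAGT2010, Examples 3.1(a)] -/
theorem cappellShanesonFamilyBarrier_of_leaves (hΔ : gompf2010_deltaMove.{0})
    (h43 : gompf2010_akbulutKirby_framings.{0, 0}) (hAK : akbulutKirby1979_sphere_four) :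
    CappellShanesonFamilyBarrier :=
  cappellShanesonFamilyBarrier_of_deltaMove_of_akbulutKirby hΔ (allSpheresStandard_akbulutKirby_of h43 hAK)


/-- **The barrier from the current geometric leaf set** of the tree's decomposition of
Examples 3.1(a): the framed Theorem 2.1 for the Δ-moves **F** (`gompf2010_framedTwist`, §4 ¶3) and
for the Δ₀-moves **F₀** (`gompf2010_framedTwistZero`, §4 ¶5), and [AK1] in the framed form
(`akbulutKirby1979_linearStraightening`); the framings of the section circle **S**,
straightening-class invariance **W**, conjugation invariance **Cj**, `π₁ GL⁺(3, ℝ) = ℤ/2` and the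
essential framing loop of the proof of Thm 4.3 are all proved in the tree
(`nonempty_diffeomorph_sphere_four_of_isCappellShanesonSphereOf_of_twist_AK`). When these three
leaves are discharged, `CappellShanesonFamilyBarrier_holds` is this theorem applied to their
proofs. [cite: GompfAGT2010, Examples 3.1(a), §4 ¶3 and ¶5, Thm 4.3] -/
theorem cappellShanesonFamilyBarrier_of_twist_AK (hF : gompf2010_framedTwist)
    (hF₀ : gompf2010_framedTwistZero) (hAK : akbulutKirby1979_linearStraightening) :
    CappellShanesonFamilyBarrier :=
  cappellShanesonFamilyBarrier_iff_familyStandard.2 fun X _ _ _ _ _ _ =>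
    nonempty_diffeomorph_sphere_four_of_isCappellShanesonSphereOf_of_twist_AK X hF hF₀ hAK

/-- **The historical route: the framed Δ-move and both concrete `A₀`-spheres.** Granted **F**
(`gompf2010_framedTwist`) and that *both* concrete spheres `gompfSphere A₀ γ` are `S⁴` — in
print [AK1] for the untwisted framing (Akbulut–Kirby 1979) and [AK2] followed by [Sig0] (Gompf,
*Killing the Akbulut–Kirby 4-sphere*, Topology 30 (1991)) for the
twisted one (Gompf 2010, §1: "Akbulut and Kirby … [AK2]. This was then shown by the author to be
diffeomorphic to `S⁴` [Sig0]"; Examples 3.1(a): "or [AK2] followed by [Sig0], in the twisted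
case") — the barrier follows without Theorem 4.3: the Δ-move comes from **F** and the proved
classification (`gompf2010_deltaMove_of_framedTwist`), the `A₀` input from
`allSpheresStandard_of_gompfSphere`. [cite: GompfAGT2010, §1 and Examples 3.1(a)] [cite: AkbulutKirby1985, §1] [cite: Gompf1991Killing, main theorem] -/
theorem cappellShanesonFamilyBarrier_of_framedTwist_of_gompfSphere (hF : gompf2010_framedTwist)
    (h₀ : ∀ γ : SmoothMatrixPath (slRealMatrix akbulutKirbyMatrix),
      Nonempty (gompfSphere akbulutKirbyMatrix γ ≃ₘ⟮𝓡 4, 𝓡 4⟯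
        (Metric.sphere (0 : EuclideanSpace ℝ (Fin (4 + 1))) 1))) :
    CappellShanesonFamilyBarrier :=
  cappellShanesonFamilyBarrier_of_deltaMove_of_akbulutKirby
    (gompf2010_deltaMove_of_framedTwist hF gompf2010_straightening_classification_holds)
    (allSpheresStandard_of_gompfSphere _ h₀)

/-- The barrier from **Gompf's Thm. 3.2, last sentence** (`gompf2010_theorem32_d`: `|d| < 17`;
`Aₘ` has `d = 1`), i.e. from the small-entry barrier by monotonicity. [cite: GompfAGT2010, Thm. 3.2 and Examples 3.1(a)] -/
theorem cappellShanesonFamilyBarrier_of_theorem32_d (h : gompf2010_theorem32_d.{0}) :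
    CappellShanesonFamilyBarrier :=
  cappellShanesonFamilyBarrier_of_smallEntry (cappellShanesonSmallEntryBarrier_of_gompf h)

/-- The barrier from **Kim–Yamada's trace range and the Δ-move** (Kim–Yamada 2023, Thm. B with
Remark 1.1: traces in `[-64, 69]` are standard — which alone covers only `-66 ≤ m ≤ 67`, since
`tr Aₘ = m + 2`; the Δ-move brings every `Aₘ` to trace `2`), via
`gompf2010_theorem32_d_of_kimYamada`. [cite: KimYamada2023, Thm. B and Remark 1.1] -/
theorem cappellShanesonFamilyBarrier_of_kimYamada (hΔ : gompf2010_deltaMove.{0})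
    (hKY : kimYamada2023_nonempty_diffeomorph_sphere_four_of_trace_mem_Icc.{0}) :
    CappellShanesonFamilyBarrier :=
  cappellShanesonFamilyBarrier_of_theorem32_d (gompf2010_theorem32_d_of_kimYamada hΔ hKY)

/-- **The barrier from the current leaf set {F, [AK1]}**: the framed Theorem 2.1 for the
Δ-moves **F** (`gompf2010_framedTwist`, §4 ¶3) and [AK1] in the framed form
(`akbulutKirby1979_linearStraightening`) — the Δ₀-instance **F₀** being a consequence of **F** by
Gompf's change of basis (`gompf2010_framedTwistZero_of_framedTwist`, `GompfFramedTwistZero.lean`;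
§4 ¶5: the Δ₀-move "can be realized by left or right multiplication by some `Δᵏ` after a
suitable change of basis"). When these two leaves are discharged,
`CappellShanesonFamilyBarrier_holds` is this theorem applied to their proofs. [cite: GompfAGT2010, Examples 3.1(a), §4 ¶3 and ¶5, Thm 4.3] -/
theorem cappellShanesonFamilyBarrier_of_framedTwist_AK (hF : gompf2010_framedTwist)
    (hAK : akbulutKirby1979_linearStraightening) : CappellShanesonFamilyBarrier :=
  cappellShanesonFamilyBarrier_of_twist_AK hF (gompf2010_framedTwistZero_of_framedTwist hF) hAK

end FamilyBarrier

end Literature.Barriers.SmoothPoincare4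

/-! ## Part IV — Thm. 3.4 from the Δ-move and Examples 3.1(a), and from the live leaves

Appended by the provefact unit of the former named fact `gompf2010_theorem34` (Gompf 2010, §3,
Thm. 3.4; p. 8 of arXiv:0908.1914: "Suppose the Cappell-Shaneson matrix `A` can be conjugated to
standard form with `c ≡ r` mod `d` or mod `a + ce` where `-3 ≤ r ≤ 4`. Then both homotopy spheres
associated to `A` are diffeomorphic to `S⁴`."), and kept by its review (2026-08-15), which merged
the fact back into the proof obligation of `gompf2010_corollary35`: the statement of Thm. 3.4 is
now the literal conclusion of the theorems below rather than a named fact. The printed proof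
("Proof of Theorem 3.4", loc. cit.) is formalised in full in section `Theorem34` above; what it consumes
from outside §3 is exactly (1) the Δ-move of Theorem 2.1/§3 ¶3 (`gompf2010_deltaMove`; the column
move is derived, `gompf2010_deltaMoveRight_of_deltaMove`) and (2) "reduce to some `Aₘ`", i.e.
that every sphere of every `Aₘ` is standard (`FamilyStandard`, Examples 3.1(a); in print also
Akbulut 2010, Thm. 1). This part records that sharp dependency
(`gompf2010_theorem34_of_deltaMove_of_familyStandard`), its reading at `Type` through the family
barrier (`gompf2010_theorem34_of_deltaMove_of_familyBarrier`), and the reduction of Thm. 3.4 to the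
tree's CURRENT leaf set {**F**, [AK1]} (`gompf2010_theorem34_of_framedTwist_AK`: the framed
Theorem 2.1 `gompf2010_framedTwist` and `akbulutKirby1979_linearStraightening`; the section-circle
framings **S**, straightening invariance **W**, conjugation invariance **Cj**, `π₁ GL⁺(3, ℝ) = ℤ/2`,
the essential framing loop of Thm. 4.3 and **F₀ ⇐ F** are all proved in the tree). Both remaining
leaves are theories (logarithmic transformations in a fishtail neighbourhood; Kirby calculus on
the Akbulut–Kirby diagram) and named facts of `Literature/Topology/FourManifolds/` with their own
units; when `gompf2010_framedTwist_holds` and `akbulutKirby1979_linearStraightening_holds` land,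
Thm. 3.4 outright is `gompf2010_theorem34_of_framedTwist_AK` applied to them. No named fact is
introduced here (D-0026).
-/

namespace Literature.Barriers.SmoothPoincare4

universe u

open scoped MatrixGroups

section Theorem34Frontier

/-- **Thm. 3.4 from the Δ-move and the standardness of the family `Aₘ`** — the sharp printed
dependency: Gompf's proof of Thm. 3.4 manipulates `A` by conjugations and Δ-moves (row move
`gompf2010_deltaMove`, Thm. 2.1/§3 ¶3; the column move used "in the mod `d` case" is its conjugate,
`gompf2010_deltaMoveRight_of_deltaMove`) until `c (c - 1) = 0`, where `d = ±1` and one can "reduce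
to some `Aₘ` by hand", whose spheres are standard (`FamilyStandard`, Examples 3.1(a)). Everything
else — the shear to `e = 0`, moves (i)/(ii), the base case, the descent on `|c|` — is proved in
section `Theorem34`. [cite: GompfAGT2010, Thm. 3.4 (proof)] -/
theorem gompf2010_theorem34_of_deltaMove_of_familyStandard (hΔ : gompf2010_deltaMove.{u})
    (hAm : FamilyStandard.{u}) :
    ∀ (A P : SL(3, ℤ)) (r : ℤ), (A.1 - 1).det = 1 → IsGompfStandardForm (P * A * P⁻¹) →
      r ∈ Icc (-3 : ℤ) 4 →
      ((P * A * P⁻¹).1 1 1 ≡ r [ZMOD (P * A * P⁻¹).1 1 2] ∨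
        (P * A * P⁻¹).1 1 1 ≡ r [ZMOD (P * A * P⁻¹).1 0 1 +
          (P * A * P⁻¹).1 1 1 * (P * A * P⁻¹).1 2 1]) →
      AllSpheresStandard.{u} A := by
  intro A P r hdet hsf hr hmod
  rw [← allSpheresStandard_conj_iff A P]
  have hdetB : ((P * A * P⁻¹).1 - 1).det = 1 := by rw [det_coe_conj_sub_one]; exact hdet
  rcases hmod with hmod | hmod
  · exact allSpheresStandard_of_modEq_d hΔ hAm hsf hdetB hr hmod
  · exact allSpheresStandard_of_modEq_sum hΔ hAm hsf hdetB hr hmod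

/-- **Thm. 3.4 at `Type` from the Δ-move and the family barrier.** Since
`CappellShanesonFamilyBarrier` (no sphere of any `Aₘ` is exotic; Akbulut 2010, Thm. 1, and Gompf
2010, Examples 3.1(a)) is *equivalent* to `FamilyStandard.{0}`
(`cappellShanesonFamilyBarrier_iff_familyStandard`), Thm. 3.4 for spheres `X : Type` needs only
the Δ-move beyond it. [cite: GompfAGT2010, Thm. 3.4 (proof) and Examples 3.1(a)] [cite: Akbulut2010, Thm. 1] -/
theorem gompf2010_theorem34_of_deltaMove_of_familyBarrier (hΔ : gompf2010_deltaMove.{0})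
    (hB : CappellShanesonFamilyBarrier) :
    ∀ (A P : SL(3, ℤ)) (r : ℤ), (A.1 - 1).det = 1 → IsGompfStandardForm (P * A * P⁻¹) →
      r ∈ Icc (-3 : ℤ) 4 →
      ((P * A * P⁻¹).1 1 1 ≡ r [ZMOD (P * A * P⁻¹).1 1 2] ∨
        (P * A * P⁻¹).1 1 1 ≡ r [ZMOD (P * A * P⁻¹).1 0 1 +
          (P * A * P⁻¹).1 1 1 * (P * A * P⁻¹).1 2 1]) →
      AllSpheresStandard.{0} A :=
  gompf2010_theorem34_of_deltaMove_of_familyStandard hΔ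
    (cappellShanesonFamilyBarrier_iff_familyStandard.1 hB)

/-- **Thm. 3.4 from the current leaf set {F, [AK1]}.** The three hypotheses of
`gompf2010_theorem34_of_leaves'` come from the framed Theorem 2.1 **F** (`gompf2010_framedTwist`,
§4 ¶3) and [AK1] in the framed form (`akbulutKirby1979_linearStraightening`): the Δ-move by
`gompf2010_deltaMove_of_framedTwist` with the proved classification of spheres by straightenings
(`gompf2010_straightening_classification_holds`, §4 ¶2), the framing-free Theorem 4.3 by
`gompf2010_akbulutKirby_framings_of_framedTwist` (W, Cj, `π₁ GL⁺(3, ℝ) = ℤ/2`, the essential loop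
`τ·ρ` and F₀ ⇐ F proved in the tree), and `akbulutKirby1979_sphere_four_of_framed`. When these two
leaves are discharged, this theorem applied to their proofs is Thm. 3.4 outright.
[cite: GompfAGT2010, Thm. 3.4 (proof), §4 ¶3 and Thm 4.3] [cite: AkbulutKirby1979, main theorem (Σ ≅ S⁴)] -/
theorem gompf2010_theorem34_of_framedTwist_AK (hF : gompf2010_framedTwist)
    (hAK : akbulutKirby1979_linearStraightening) :
    ∀ (A P : SL(3, ℤ)) (r : ℤ), (A.1 - 1).det = 1 → IsGompfStandardForm (P * A * P⁻¹) →
      r ∈ Icc (-3 : ℤ) 4 →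
      ((P * A * P⁻¹).1 1 1 ≡ r [ZMOD (P * A * P⁻¹).1 1 2] ∨
        (P * A * P⁻¹).1 1 1 ≡ r [ZMOD (P * A * P⁻¹).1 0 1 +
          (P * A * P⁻¹).1 1 1 * (P * A * P⁻¹).1 2 1]) →
      AllSpheresStandard.{u} A :=
  gompf2010_theorem34_of_leaves'
    (gompf2010_deltaMove_of_framedTwist hF gompf2010_straightening_classification_holds)
    (gompf2010_akbulutKirby_framings_of_framedTwist hF)
    (akbulutKirby1979_sphere_four_of_framed hAK)

end Theorem34Frontier

end Literature.Barriers.SmoothPoincare4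

end
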